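import Mathlib
import HarnessLib
import Summits.HubbardSuperconductivity.HubbardSuperconductivity.Theorems.KLProgrammeKLRegimeEnginePairTransferStep7AnalyticResolvedSizedKlTS8Pinned2SBUnguarded
import Summits.HubbardSuperconductivity.HubbardSuperconductivity.Theorems.KLProgrammeKLRegimeEngineV8TwoLegSpaceMomentsExportZ

/-!
# Route `KLProgramme` — crux K3 ENGINE (stmt-HubbardSuperconductivity-20437 `KLRegimeEngineV17F2`), row (X) `stub_engine_exports` (b5ef244eede8) BY TYPE over the
# SB one-call (`…_pinned2sb_unguarded`: the scale-0 BASE scalar row re-keyed on k3c5-p1 g22's CLOSED second-order base `klmf_baseData_of_scaleZero_secondOrder`, ✓ p737743)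
# — `…_of_class5RowsSB`, `…_of_class5RowsCapSB` (cell gate-hubbard-kl, seat hubbard-kl-k3c1-p1 g23; LR20 exit test (E3), pen (R534)(A)/(R540)(A); twins of ✓ p729777's readers)

WHY.  ✓ p729777 read row (X) through «95v2», whose scale-0 BASE scalar row carried `(4/6047)·klTransferC R ≥ 2⁹¹` per unit mass and was undischargeable uniformly in `P`
(✓ p731331, located «(X).2′-BASE-ROOM»).  The SB chain (this seat, (E3)) re-keys that row on `klmf_baseData_of_scaleZero_secondOrder`: per pair at scale 0 the two a priori member rows and
the CLOSED scalar inequality `(160·klIdxMass 0 j′·U² + 2²⁰/12108³·klScaleZeroCV R·klScaleZeroThetaC R²·klIdxMass 0 j′·U³) + 4(mA U)²·klIdxMass 0 j′ ≤ θ·r·(Klam U)²·klIdxMass 0 j′` (U²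
coefficient 160 ABSOLUTE; dischargeable inside the cap for `U ≤ U₀(P,R)` at every `Klam ≥ 1`) — no new datum, no supplier row.  These are ✓ p729777's two readers with the one-call swapped:
* **`A24a1G14.stub_engine_exports_of_class5RowsSB hX1 h5 hX3`** ⊢ row (X) verbatim — `h5 : ∀ P R, P.WF → R.WF2 → ∃ r θ u mA, doors ∧ hmA ∧ hbase ∧ hsucc ∧ hexport` (texts of the SB one-call at
  `Q₀ := klEngQ7 P R`, `G := klEngGeo14`, `Gth := klEngGeoTh`; plumbing `hR hCF hKl h0` discharged);
* **`A24a1G14.stub_engine_exports_of_class5RowsCapSB hX1 h5c hX3`** — `r := klCTcap8`, `θ := 1/5`; residual data `u mA`.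
Bookkeeping; `hX1`, `h5/h5c`, `hX3` are producer rows with NO supplier and are NOT asserted; nothing asserts row (X), any stub, K3, U₀, the window or superconductivity.  0 kit · 0 lit.
References: BGM 2006 §2.4 (2.36), §3 Thm 3.1 [cite: BenfattoGiulianiMastropietro2006].
-/


noncomputable section

namespace Summit.HubbardSuperconductivity.HubbardSuperconductivity.Theorems.EngineV8.A24a1G14

set_option linter.dupNamespace false -- summit = problem name (single-conjunct summit), D-0017

open Finset Matrix Set Literature.MathematicalPhysics.QuantumLattice Literature.Probability.LatticeModels GrassmannAlgebra
open Literature.MathematicalPhysics.QuantumLattice.FermiRG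
open Summit.HubbardSuperconductivity.HubbardSuperconductivity.Theorems.KLProgrammeCooperResummation
open Summit.HubbardSuperconductivity.HubbardSuperconductivity.Theorems.KLProgrammeLegKernels
open Summit.HubbardSuperconductivity.HubbardSuperconductivity.Theorems.TwoPointAssembly
open Summit.HubbardSuperconductivity.HubbardSuperconductivity.Theorems.DispersionFlow
open Summit.HubbardSuperconductivity.HubbardSuperconductivity.Theorems.KLRegimeWick
open Summit.HubbardSuperconductivity.HubbardSuperconductivity.Theorems.KLRegimeSplit
open Summit.HubbardSuperconductivity.HubbardSuperconductivity.Theorems.EngineV8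

section RowX

set_option maxHeartbeats 3200000 in -- long binder lists
/-- **ROW (X) BY TYPE over the SB one-call (LR20 (E3))** (data `r θ u mA`): `h5` = the producer rows of `…_pinned2sb_unguarded` verbatim at the registered tokens. ⊢ row (X) verbatim. [cite: BenfattoGiulianiMastropietro2006, §2.4 (2.36), §3 Thm 3.1] -/
theorem stub_engine_exports_of_class5RowsSB
    (hX1 : ∀ (P : SplitConsts) (R : RenConsts), P.WF → R.WF2 →
      ∃ e : (ℕ → ℝ) × ℝ × (EngConsts → ℝ → ℝ), IsExportPkg2 e ∧ LevelsUStep2 P R (klEngQ7 P R) e.1 e.2.2)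
    (h5 : ∀ (P : SplitConsts) (R : RenConsts), P.WF → R.WF2 →
      ∃ (r θ : ℝ) (u : EngConsts → ℝ → ℝ) (mA : ℝ → ℝ), (0 ≤ r ∧ r ≤ klCTcap8 ∧ (∀ Q cc, 0 < u Q cc) ∧ 0 ≤ θ ∧ θ ≤ 1 / 5) ∧
      -- `hmA`
      (∀ (Q : EngConsts) (cc U : ℝ), 0 < U → U ≤ u Q cc → 0 ≤ mA U ∧ mA U * ((2 : ℝ) ^ 10 * 15367) ≤ 1 / 3) ∧
      -- `hbase` (SB: a priori rows + the CLOSED second-order scalar row `160·ms·U² + 2²⁰/12108³·CV·ΘC²·ms·U³ + 4(mA U)²ms ≤ θ r (KlamU)² ms`)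
      (klEngGeo14.WF → ∀ Q : EngConsts, (klEngQ7 P R).IsRaiseOf Q → ∀ cc : ℝ, 0 < cc → cc ≤ klEngC₃6 P R → ∀ μ ∈ klWindowC, ∀ U : ℝ, 0 < U → U ≤ klEngU₀10 P R cc → U ≤ u Q cc → ∀ β : ℝ, klBetaMin ≤ β → β ≤ Real.exp (cc / U ^ 2) → ∀ (L M : ℕ) [NeZero L] [NeZero M], klEngL₄ P R β U ≤ L → klEngM₃ β U L ≤ M →
      0 ≤ nScales β + 1 → IsKLRegime U cc (-((0 : ℕ) : ℤ)) → HistP klPredsV17F2 L M klEngGeo14 P Q R β U μ 0 0 → FrameOK R U (nScales β) μ (klFlowFrameU L M β U μ 0) → (∀ j ≤ 0, LevelsUExportMixedAt L M (klCU2 P R (klEngQ7 P R)) P β U μ j) → ∀ j j' : ℕ, 0 ≤ j' → j' ≤ j → j ≤ nScales β + 1 → ∀ Qm : TorusSite 2 L,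
      -- BASE CLOSED at scale 0, SECOND ORDER EXPLICIT (k3c5-p1 g22 `klmf_baseData_of_scaleZero_secondOrder`; re-key k3c1-p1 g23): the two a priori rows
      -- [class #1] and ONE scalar inequality of the depth `j′` (`klTransferC R` = k3c2-p1 g5's closed scale-0 transfer constant)
      (∀ x y, ‖klMemberArrayF L M β U μ 0 (softSymbolCompl L M β μ (klFlowFrameU L M β U μ 0) 0 j) Qm x y‖ ≤ mA U) ∧ (∀ x y, ‖klMemberArrayF L M β U μ 0 (softSymbolCompl L M β μ (klFlowFrameU L M β U μ 0) 0 j') Qm x y‖ ≤ mA U) ∧ (160 * klIdxMass 0 j' * U ^ 2 + 2 ^ 20 / 12108 ^ 3 * klScaleZeroCV R * klScaleZeroThetaC R ^ 2 * klIdxMass 0 j' * U ^ 3) +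
      4 * (mA U * mA U) * klIdxMass 0 j' ≤ θ * (r * ((P.Klam * U) ^ 2 * klIdxMass 0 j'))) ∧
      -- `hsucc`
      (klEngGeo14.WF → ∀ Q : EngConsts, (klEngQ7 P R).IsRaiseOf Q →
      ∀ cc : ℝ, 0 < cc → cc ≤ klEngC₃6 P R → ∀ μ ∈ klWindowC, ∀ U : ℝ, 0 < U → U ≤ klEngU₀10 P R cc → U ≤ u Q cc → ∀ β : ℝ, klBetaMin ≤ β → β ≤ Real.exp (cc / U ^ 2) → ∀ (L M : ℕ) [NeZero L] [NeZero M], klEngL₄ P R β U ≤ L → klEngM₃ β U L ≤ M → ∀ n : ℕ, n + 1 ≤ nScales β + 1 → IsKLRegime U cc (-((n + 1 : ℕ) : ℤ)) → HistP klPredsV17F2 L M klEngGeo14 P Q R β U μ 0 (n + 1) →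
      FrameOK R U (nScales β) μ (klFlowFrameU L M β U μ (n + 1)) → (∀ j ≤ n + 1, LevelsUExportMixedAt L M (klCU2 P R (klEngQ7 P R)) P β U μ j) → (∀ Λ ∈ Icc (klScale klE0 (n + 1)) (klScale klE0 n), hubbardEffPartitionFnCT L M β U μ 0 (klFlowFrameU L M β U μ (n + 1)) Λ ≠ 0) ∧ ∀ (A A' : ℕ → TorusSite 2 L → ℝ → Matrix (TorusSite 2 L) (TorusSite 2 L) ℂ) (b b' : ℕ → TorusSite 2 L → ℝ → TorusSite 2 L → ℂ)
      (a : ℕ → ℕ → TorusSite 2 L → ℝ → TorusSite 2 L → ℂ) (ρ : ℕ → TorusSite 2 L → TorusSite 2 L → ℝ) (V : ℕ → ℝ → (Fin 4 → HubbardFieldIdx L M) → ℂ) (V6 : ℕ → ℝ → (Fin 6 → HubbardFieldIdx L M) → ℂ) (Sg : ℕ → ℝ → FreqMomentum L M → Fin 2 → ℂ) (Hd : ℕ → ℝ → (Fin 4 → HubbardFieldIdx L M) → ℂ) (Φ : ℕ → ℝ → FreqMomentum L M → ℝ) (Wd : ℝ →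
      FreqMomentum L M → ℝ) (Br : ℕ → TorusSite 2 L → ℝ → TorusSite 2 L × MatsubaraIdx M → ℂ), (A = fun j Qm t => Matrix.of fun k k' : TorusSite 2 L => if k ∈ klBall L μ 0 ∧ k' ∈ klBall L μ 0 then vertexFn L M β (gaussConv ℂ
      (softCovOf L M β μ (klFlowFrameU L M β U μ (n + 1)) (softSymbolCompl L M β μ (klFlowFrameU L M β U μ (n + 1)) (n + 1) j) + hubbardCovAboveCT L M β μ 0 (klFlowFrameU L M β U μ (n + 1)) (klScale klE0 (n + 1)) - hubbardCovAboveCT L M β μ 0 (klFlowFrameU L M β U μ (n + 1)) (klScale klE0 n + t * (klScale klE0 (n + 1) - klScale klE0 n)))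
      (hubbardEffectiveActionCT L M β U μ 0 (klFlowFrameU L M β U μ (n + 1)) (klScale klE0 n + t * (klScale klE0 (n + 1) - klScale klE0 n)))) 4 ![(((omega0 M, k'), 0), 0), ((((omega0 M).rev, Qm - k'), 1), 0), ((((omega0 M).rev, Qm - k), 1), 1), (((omega0 M, k), 0), 1)] else 0) → (A' = fun j Qm t => Matrix.of fun k k' : TorusSite 2 L => if k ∈ klBall L μ 0 ∧ k' ∈ klBall L μ 0 then
      (klScale klE0 (n + 1) - klScale klE0 n) • -((2 : ℂ)⁻¹ * vertexFn L M β (gaussConv ℂ (softCovOf L M β μ (klFlowFrameU L M β U μ (n + 1)) (softSymbolCompl L M β μ (klFlowFrameU L M β U μ (n + 1)) (n + 1) j) + hubbardCovAboveCT L M β μ 0 (klFlowFrameU L M β U μ (n + 1)) (klScale klE0 (n + 1)) -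
      hubbardCovAboveCT L M β μ 0 (klFlowFrameU L M β U μ (n + 1)) (klScale klE0 n + t * (klScale klE0 (n + 1) - klScale klE0 n))) (grassmannDerivPairing ℂ (Matrix.of fun X Y : HubbardFieldIdx L M => deriv (fun Λ'' : ℝ => hubbardCovAboveCT L M β μ 0 (klFlowFrameU L M β U μ (n + 1)) Λ'' X Y) (klScale klE0 n + t * (klScale klE0 (n + 1) - klScale klE0 n)))
      (hubbardEffectiveActionCT L M β U μ 0 (klFlowFrameU L M β U μ (n + 1)) (klScale klE0 n + t * (klScale klE0 (n + 1) - klScale klE0 n))) (hubbardEffectiveActionCT L M β U μ 0 (klFlowFrameU L M β U μ (n + 1)) (klScale klE0 n + t * (klScale klE0 (n + 1) - klScale klE0 n))))) 4 ![(((omega0 M, k'), 0), 0), ((((omega0 M).rev, Qm - k'), 1), 0), ((((omega0 M).rev, Qm - k), 1), 1), (((omega0 M, k), 0), 1)]) else 0) →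
      (b = fun j Qm t p => -((klBubbleMass L M β μ (klFlowFrameU L M β U μ (n + 1)) (fun k => (softSymbolCompl L M β μ (klFlowFrameU L M β U μ (n + 1)) (n + 1) j) k + (hubbardCutoffWeightCT L M β μ (klFlowFrameU L M β U μ (n + 1)) (klScale klE0 (n + 1)) k - hubbardCutoffWeightCT L M β μ (klFlowFrameU L M β U μ (n + 1)) (klScale klE0 n + t * (klScale klE0 (n + 1) - klScale klE0 n)) k))
      (fun k => (softSymbolCompl L M β μ (klFlowFrameU L M β U μ (n + 1)) (n + 1) j) k + (hubbardCutoffWeightCT L M β μ (klFlowFrameU L M β U μ (n + 1)) (klScale klE0 (n + 1)) k - hubbardCutoffWeightCT L M β μ (klFlowFrameU L M β U μ (n + 1)) (klScale klE0 n + t * (klScale klE0 (n + 1) - klScale klE0 n)) k)) Qm p : ℝ) : ℂ)) → (b' = fun j Qm t p => (((klScale klE0 (n + 1) - klScale klE0 n) *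
      (klBubbleMass L M β μ (klFlowFrameU L M β U μ (n + 1)) (fun k => deriv (fun Λ' => hubbardCutoffWeightCT L M β μ (klFlowFrameU L M β U μ (n + 1)) Λ' k) (klScale klE0 n + t * (klScale klE0 (n + 1) - klScale klE0 n))) (fun k => (softSymbolCompl L M β μ (klFlowFrameU L M β U μ (n + 1)) (n + 1) j) k + (hubbardCutoffWeightCT L M β μ (klFlowFrameU L M β U μ (n + 1)) (klScale klE0 (n + 1)) k -
      hubbardCutoffWeightCT L M β μ (klFlowFrameU L M β U μ (n + 1)) (klScale klE0 n + t * (klScale klE0 (n + 1) - klScale klE0 n)) k)) Qm p + klBubbleMass L M β μ (klFlowFrameU L M β U μ (n + 1)) (fun k => (softSymbolCompl L M β μ (klFlowFrameU L M β U μ (n + 1)) (n + 1) j) k + (hubbardCutoffWeightCT L M β μ (klFlowFrameU L M β U μ (n + 1)) (klScale klE0 (n + 1)) k -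
      hubbardCutoffWeightCT L M β μ (klFlowFrameU L M β U μ (n + 1)) (klScale klE0 n + t * (klScale klE0 (n + 1) - klScale klE0 n)) k)) (fun k => deriv (fun Λ' => hubbardCutoffWeightCT L M β μ (klFlowFrameU L M β U μ (n + 1)) Λ' k) (klScale klE0 n + t * (klScale klE0 (n + 1) - klScale klE0 n))) Qm p) : ℝ) : ℂ)) → (a = fun j j' Qm t p => (b j Qm t p - b j' Qm t p) +
      (-(((klTransferWeight L M β μ (klFlowFrameU L M β U μ (n + 1)) (n + 1) (softSymbolCompl L M β μ (klFlowFrameU L M β U μ (n + 1)) (n + 1) j) Qm p - klTransferWeight L M β μ (klFlowFrameU L M β U μ (n + 1)) (n + 1) (softSymbolCompl L M β μ (klFlowFrameU L M β U μ (n + 1)) (n + 1) j') Qm p : ℝ)) : ℂ) - (b j Qm 1 p - b j' Qm 1 p))) →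
      (ρ = fun j Qm c => klRungProfile L M β μ (klFlowFrameU L M β U μ (n + 1)) n (softSymbolCompl L M β μ (klFlowFrameU L M β U μ (n + 1)) (n + 1) j) Qm c) → (V = fun j t X => vertexFn L M β (gaussConv ℂ (softCovOf L M β μ (klFlowFrameU L M β U μ (n + 1)) (softSymbolCompl L M β μ (klFlowFrameU L M β U μ (n + 1)) (n + 1) j) + hubbardCovAboveCT L M β μ 0 (klFlowFrameU L M β U μ (n + 1)) (klScale
      klE0 (n + 1)) - hubbardCovAboveCT L M β μ 0 (klFlowFrameU L M β U μ (n + 1)) (klScale klE0 n + t * (klScale klE0 (n + 1) - klScale klE0 n))) (hubbardEffectiveActionCT L M β U μ 0 (klFlowFrameU L M β U μ (n + 1)) (klScale klE0 n + t * (klScale klE0 (n + 1) - klScale klE0 n)))) 4 X) →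
      (V6 = fun j t X => vertexFn L M β (gaussConv ℂ (softCovOf L M β μ (klFlowFrameU L M β U μ (n + 1)) (softSymbolCompl L M β μ (klFlowFrameU L M β U μ (n + 1)) (n + 1) j) + hubbardCovAboveCT L M β μ 0 (klFlowFrameU L M β U μ (n + 1)) (klScale
      klE0 (n + 1)) - hubbardCovAboveCT L M β μ 0 (klFlowFrameU L M β U μ (n + 1)) (klScale klE0 n + t * (klScale klE0 (n + 1) - klScale klE0 n))) (hubbardEffectiveActionCT L M β U μ 0 (klFlowFrameU L M β U μ (n + 1)) (klScale klE0 n + t * (klScale klE0 (n + 1) - klScale klE0 n)))) 6 X) →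
      (Sg = fun j t p σ => selfEnergy L M β (gaussConv ℂ (softCovOf L M β μ (klFlowFrameU L M β U μ (n + 1)) (softSymbolCompl L M β μ (klFlowFrameU L M β U μ (n + 1)) (n + 1) j) + hubbardCovAboveCT L M β μ 0 (klFlowFrameU L M β U μ (n + 1))
      (klScale klE0 (n + 1)) - hubbardCovAboveCT L M β μ 0 (klFlowFrameU L M β U μ (n + 1)) (klScale klE0 n + t * (klScale klE0 (n + 1) - klScale klE0 n))) (hubbardEffectiveActionCT L M β U μ 0 (klFlowFrameU L M β U μ (n + 1)) (klScale klE0 n + t * (klScale klE0 (n + 1) - klScale klE0 n)))) p σ) →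
      (Hd = fun j t X => vertexFn L M β (dblFold ℂ (grassmannLaplacian ℂ (crossCov ℂ (Matrix.of fun X Y : HubbardFieldIdx L M => deriv (fun Λ' : ℝ => hubbardCovAboveCT L M β μ 0 (klFlowFrameU L M β U μ (n + 1)) Λ' X Y) (klScale klE0 n + t *
      (klScale klE0 (n + 1) - klScale klE0 n)))) ((gaussConv ℂ (crossCov ℂ (softCovOf L M β μ (klFlowFrameU L M β U μ (n + 1)) (softSymbolCompl L M β μ (klFlowFrameU L M β U μ (n + 1)) (n + 1) j) + hubbardCovAboveCT L M β μ 0 (klFlowFrameU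
      L M β U μ (n + 1)) (klScale klE0 (n + 1)) - hubbardCovAboveCT L M β μ 0 (klFlowFrameU L M β U μ (n + 1)) (klScale klE0 n + t * (klScale klE0 (n + 1) - klScale klE0 n)))) - grassmannLaplacian ℂ (crossCov ℂ (softCovOf L M β μ
      (klFlowFrameU L M β U μ (n + 1)) (softSymbolCompl L M β μ (klFlowFrameU L M β U μ (n + 1)) (n + 1) j) + hubbardCovAboveCT L M β μ 0 (klFlowFrameU L M β U μ (n + 1)) (klScale klE0 (n + 1)) - hubbardCovAboveCT L M β μ 0 (klFlowFrameU L
      M β U μ (n + 1)) (klScale klE0 n + t * (klScale klE0 (n + 1) - klScale klE0 n))))) (dblCopy ℂ 0 (gaussConv ℂ (softCovOf L M β μ (klFlowFrameU L M β U μ (n + 1)) (softSymbolCompl L M β μ (klFlowFrameU L M β U μ (n + 1)) (n + 1) j) +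
      hubbardCovAboveCT L M β μ 0 (klFlowFrameU L M β U μ (n + 1)) (klScale klE0 (n + 1)) - hubbardCovAboveCT L M β μ 0 (klFlowFrameU L M β U μ (n + 1)) (klScale klE0 n + t * (klScale klE0 (n + 1) - klScale klE0 n)))
      (hubbardEffectiveActionCT L M β U μ 0 (klFlowFrameU L M β U μ (n + 1)) (klScale klE0 n + t * (klScale klE0 (n + 1) - klScale klE0 n)))) * dblCopy ℂ 1 (gaussConv ℂ (softCovOf L M β μ (klFlowFrameU L M β U μ (n + 1)) (softSymbolCompl L
      M β μ (klFlowFrameU L M β U μ (n + 1)) (n + 1) j) + hubbardCovAboveCT L M β μ 0 (klFlowFrameU L M β U μ (n + 1)) (klScale klE0 (n + 1)) - hubbardCovAboveCT L M β μ 0 (klFlowFrameU L M β U μ (n + 1)) (klScale klE0 n + t * (klScale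
      klE0 (n + 1) - klScale klE0 n))) (hubbardEffectiveActionCT L M β U μ 0 (klFlowFrameU L M β U μ (n + 1)) (klScale klE0 n + t * (klScale klE0 (n + 1) - klScale klE0 n)))))))) 4 X) →
      (Φ = fun j t k => (softSymbolCompl L M β μ (klFlowFrameU L M β U μ (n + 1)) (n + 1) j) k + (hubbardCutoffWeightCT L M β μ (klFlowFrameU L M β U μ (n + 1)) (klScale klE0 (n + 1)) k - hubbardCutoffWeightCT L M β μ (klFlowFrameU L M β U μ (n + 1)) (klScale klE0 n + t * (klScale klE0 (n + 1) - klScale klE0 n)) k)) →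
      (Wd = fun t k => deriv (fun Λ' : ℝ => hubbardCutoffWeightCT L M β μ (klFlowFrameU L M β U μ (n + 1)) Λ' k) (klScale klE0 n + t * (klScale klE0 (n + 1) - klScale klE0 n))) → (Br = fun j Qm t z => -(((((β * (L : ℝ) ^ 2 : ℝ) : ℂ)))⁻¹ * propCT L M β μ (klFlowFrameU L M β U μ (n + 1)) (z.2, z.1) * propCT L M β μ (klFlowFrameU L M β U μ (n + 1)) (z.2.rev, Qm - z.1)) *
      ((((klScale klE0 (n + 1) - klScale klE0 n) * (-Wd t (z.2, z.1) * Φ j t (z.2.rev, Qm - z.1) - Φ j t (z.2, z.1) * Wd t (z.2.rev, Qm - z.1))) : ℝ) : ℂ)) → ∀ j j' : ℕ, n + 1 ≤ j' → j' ≤ j → j ≤ nScales β + 1 → ∀ Qm : TorusSite 2 L, ∃ (ηr η₁ η₂ R₀ Φ : TorusSite 2 L → TorusSite 2 L → ℝ) (d : TorusSite 2 L → ℝ) (M4 M6 M2 η4 η6 η2 c₄ c₆ c₂ e₄ e₆ e₂ sₑ zD hD wD lD tD zX hX wX lX tX bP : ℝ)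
      (RH₁ RH₂ Rhd RL₁ RL₂ Rl₁ Rl₂ : TorusSite 2 L → TorusSite 2 L → ℝ) (Ng : ℕ → ℝ), (∀ t ∈ Icc (0 : ℝ) 1, ∀ x y, ‖A j Qm t x y‖ ≤ mA U) ∧ (∀ t ∈ Icc (0 : ℝ) 1, ∀ x y, ‖A j' Qm t x y‖ ≤ mA U) ∧
      -- class-#1 kernel inputs IN GRID-NORMS CURRENCY (rows 48/51): the pinned GRID kernel norms `Ng` of `Gg(t) = effAction (SᵀC^K_(Λ(t))S)(V_N + 𝒩_(K,N))` and the six binomial numbers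
      -- they produce (γ := √6047, κD := √(Λ_(n+1)·klIdxMass (n+1) j′) discharged); `M4 M6 M2 η4 η6 η2` are the names the `Ran` row uses
      (∀ m', 0 ≤ Ng m') ∧ (0 ≤ zD ∧ 0 ≤ hD ∧ 0 ≤ wD ∧ 0 ≤ lD ∧ 0 ≤ tD ∧ 0 ≤ zX ∧ 0 ≤ hX ∧ 0 ≤ wX ∧ 0 ≤ lX ∧ 0 ≤ tX ∧ 0 ≤ bP) ∧
      -- «88b» THE PINNED PAIR (`1 ≤ n`, `j′ = n+1`): the SIGNED direct/crossed `D`-rows in the forward windows, five-slot scalar form (binders `zD … tX`; split3 door ∘ slots)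
      (1 ≤ n → j' = n + 1 → ∀ t ∈ Icc (0 : ℝ) 1, ∀ x y : TorusSite 2 L, (4 + 8 / 3 * R.Gfr 1 * U ^ 2) * klTorusNorm L (x - y) < klScale klE0 (n + 1) / 8 → ((klScale klE0 n - klScale klE0 (n + 1)) * ((β * (L : ℝ) ^ 2) ^ 3)⁻¹) * ‖(∑ p : FreqMomentum L M, ∑ σ : Fin 2, ∑ p' : FreqMomentum L M, if matsubaraInt M p'.1 + matsubaraInt M (omega0 M) = matsubaraInt M p.1 + matsubaraInt M (omega0 M) ∧ p'.2 = p.2 + x - y then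
      ((((((((softSymbolCompl L M β μ (klFlowFrameU L M β U μ (n + 1)) (n + 1) j) p - (softSymbolCompl L M β μ (klFlowFrameU L M β U μ (n + 1)) (n + 1) j') p)) : ℝ) : ℂ) * (((β * (L : ℝ) ^ 2 : ℝ) : ℂ) * propCT L M β μ (klFlowFrameU L M β U μ (n + 1)) p)) * ((((Wd t p') : ℝ) : ℂ) * (((β * (L : ℝ) ^ 2 : ℝ) : ℂ) * propCT L M β μ
      (klFlowFrameU L M β U μ (n + 1)) p'))) + (((((Wd t p) : ℝ) : ℂ) * (((β * (L : ℝ) ^ 2 : ℝ) : ℂ) * propCT L M β μ (klFlowFrameU L M β U μ (n + 1)) p)) * ((((((softSymbolCompl L M β μ (klFlowFrameU L M β U μ (n + 1)) (n + 1) j) p' - (softSymbolCompl L M β μ (klFlowFrameU L M β U μ (n + 1)) (n + 1) j') p')) : ℝ) :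
      ℂ) * (((β * (L : ℝ) ^ 2 : ℝ) : ℂ) * propCT L M β μ (klFlowFrameU L M β U μ (n + 1)) p')))) * (V j t ![((p, σ), 1), ((p', σ), 0), (((omega0 M, y), 0), 0), (((omega0 M, x), 0), 1)] * V j t ![((p, σ), 0), ((p', σ), 1), ((((omega0 M).rev, Qm - y), 1), 0), ((((omega0 M).rev, Qm - x), 1), 1)]) else 0)‖ ≤
      (P.Klam * U) ^ 2 * (zD * ((4 : ℝ) ^ (n + 1))⁻¹ + hD * ((4 : ℝ) ^ (nScales β - n))⁻¹ + wD * ((2 : ℝ) ^ n)⁻¹ + lD * ((L : ℝ))⁻¹ + tD * min (klTorusNorm L (x - y) / klScale klE0 (n + 1)) (klScale klE0 (n + 1) / klTorusNorm L (x - y)))) ∧ (1 ≤ n → j' = n + 1 → n + 3 ≤ nScales β → ∀ t ∈ Icc (0 : ℝ) 1, ∀ x y : TorusSite 2 L, (4 + 8 / 3 * R.Gfr 1 * U ^ 2) * klTorusNorm L (x + y - Qm) < klScale klE0 (n + 1) / 16 →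
      ((klScale klE0 n - klScale klE0 (n + 1)) * ((β * (L : ℝ) ^ 2) ^ 3)⁻¹) * ‖(∑ p : FreqMomentum L M, ∑ p' : FreqMomentum L M, if matsubaraInt M p'.1 + matsubaraInt M (omega0 M) + matsubaraInt M (omega0 M) + 1 = matsubaraInt M p.1 ∧ p'.2 = p.2 + Qm - x - y then
      ((((((((softSymbolCompl L M β μ (klFlowFrameU L M β U μ (n + 1)) (n + 1) j) p - (softSymbolCompl L M β μ (klFlowFrameU L M β U μ (n + 1)) (n + 1) j') p)) : ℝ) : ℂ) * (((β * (L : ℝ) ^ 2 : ℝ) : ℂ) * propCT L M β μ (klFlowFrameU L M β U μ (n + 1)) p)) * ((((Wd t p') : ℝ) : ℂ) * (((β * (L : ℝ) ^ 2 : ℝ) : ℂ) * propCT L M β μ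
      (klFlowFrameU L M β U μ (n + 1)) p'))) + (((((Wd t p) : ℝ) : ℂ) * (((β * (L : ℝ) ^ 2 : ℝ) : ℂ) * propCT L M β μ (klFlowFrameU L M β U μ (n + 1)) p)) * ((((((softSymbolCompl L M β μ (klFlowFrameU L M β U μ (n + 1)) (n + 1) j) p' - (softSymbolCompl L M β μ (klFlowFrameU L M β U μ (n + 1)) (n + 1) j') p')) : ℝ) :
      ℂ) * (((β * (L : ℝ) ^ 2 : ℝ) : ℂ) * propCT L M β μ (klFlowFrameU L M β U μ (n + 1)) p')))) * (V j t ![((p, 0), 1), ((p', 1), 0), (((omega0 M, y), 0), 0), ((((omega0 M).rev, Qm - x), 1), 1)] * V j t ![((p, 0), 0), ((p', 1), 1), ((((omega0 M).rev, Qm - y), 1), 0), (((omega0 M, x), 0), 1)]) else 0)‖ ≤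
      (P.Klam * U) ^ 2 * (zX * ((4 : ℝ) ^ (n + 1))⁻¹ + hX * ((4 : ℝ) ^ (nScales β - n))⁻¹ + wX * ((2 : ℝ) ^ n)⁻¹ + lX * ((L : ℝ))⁻¹ + tX * min (klTorusNorm L (x + y - Qm) / klScale klE0 (n + 1)) (klScale klE0 (n + 1) / klTorusNorm L (x + y - Qm)))) ∧
      -- «88b» v2 (#15): the SIGNED born `D`-row at the pinned pair keyed to a free number `bP` in the overlap slot's shape (class #1's `TwoLegSlopes`/`KernelNormsV3` currency)
      (1 ≤ n → j' = n + 1 → ∀ t ∈ Icc (0 : ℝ) 1, ∀ x y : TorusSite 2 L,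
      ((klScale klE0 n - klScale klE0 (n + 1)) * ((β * (L : ℝ) ^ 2) ^ 3)⁻¹) *
      ‖(∑ p : FreqMomentum L M, ∑ σ : Fin 2,
      (((((Wd t p) : ℝ) : ℂ) * (((β * (L : ℝ) ^ 2 : ℝ) : ℂ) * propCT L M β μ (klFlowFrameU L M β U μ (n + 1)) p)) * ((((((softSymbolCompl L M β μ (klFlowFrameU L M β U μ (n + 1))
      (n + 1) j) p - (softSymbolCompl L M β μ (klFlowFrameU L M β U μ (n + 1)) (n + 1) j') p)) : ℝ) : ℂ) * (((β * (L : ℝ) ^ 2 : ℝ) : ℂ) * propCT L M β μ (klFlowFrameU L M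
      β U μ (n + 1)) p))) *
      (V6 j t ![((p, σ), 0), ((p, σ), 1), (((omega0 M, y), 0), 0), ((((omega0 M).rev, Qm - y), 1), 0), ((((omega0 M).rev, Qm - x), 1), 1),
      (((omega0 M, x), 0), 1)] *
      Sg j t p σ))‖ ≤
      (P.Klam * U) ^ 2 * bP * ((4 : ℝ) ^ (n + 1))⁻¹) ∧ (∀ t ∈ Icc (0 : ℝ) 1, ∀ m' (i : Fin (2 * m')) (w : GridLeg (GridPoint L (2 * (2 * M)))),
      ∑ Y ∈ univ.filter (fun Y : Fin (2 * m') → GridLeg (GridPoint L (2 * (2 * M))) => Y i = w), ‖kernel ℂ (effAction ℂ ((hubbardGridSub L M β (2 * (2 * M))).transpose * hubbardCovAboveCT L M β μ 0 (klFlowFrameU L M β U μ (n + 1)) (klScale klE0 n + t * (klScale klE0 (n + 1) - klScale klE0 n)) * hubbardGridSub L M β (2 * (2 * M)))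
      (hubbardGridInteraction L (2 * (2 * M)) β U + hubbardGridCounterQuadratic L (2 * (2 * M)) β (klFlowFrameU L M β U μ (n + 1)))) (2 * m') Y‖ ≤ Ng m') ∧ (((2 * 2).factorial : ℝ) / (β * (L : ℝ) ^ 2) * (Fintype.card (GridLeg (GridPoint L (2 * (2 * M)))) *
      ∑ m' ∈ range (Fintype.card (GridLeg (GridPoint L (2 * (2 * M)))) / 2 + 1), if 2 ≤ m' then ((2 * m').choose (2 * 2) : ℝ) * Real.sqrt 6047 ^ (2 * m' - 2 * 2) * Ng m' else 0) ≤ M4) ∧ (((2 * 3).factorial : ℝ) / (β * (L : ℝ) ^ 2) * (Fintype.card (GridLeg (GridPoint L (2 * (2 * M)))) *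
      ∑ m' ∈ range (Fintype.card (GridLeg (GridPoint L (2 * (2 * M)))) / 2 + 1), if 3 ≤ m' then ((2 * m').choose (2 * 3) : ℝ) * Real.sqrt 6047 ^ (2 * m' - 2 * 3) * Ng m' else 0) ≤ M6) ∧ (((2 * 1).factorial : ℝ) / (β * (L : ℝ) ^ 2) * (Fintype.card (GridLeg (GridPoint L (2 * (2 * M)))) *
      ∑ m' ∈ range (Fintype.card (GridLeg (GridPoint L (2 * (2 * M)))) / 2 + 1), if 1 ≤ m' then ((2 * m').choose (2 * 1) : ℝ) * Real.sqrt 6047 ^ (2 * m' - 2 * 1) * Ng m' else 0) ≤ M2) ∧ (((2 * 2).factorial : ℝ) / (β * (L : ℝ) ^ 2) * (Fintype.card (GridLeg (GridPoint L (2 * (2 * M)))) *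
      ∑ m' ∈ range (Fintype.card (GridLeg (GridPoint L (2 * (2 * M)))) / 2 + 1), if 2 < m' then ((2 * m').choose (2 * 2) : ℝ) * Real.sqrt (klScale klE0 (n + 1) * klIdxMass (n + 1) j') ^ (2 * m' - 2 * 2) * (∑ m'' ∈ range (Fintype.card (GridLeg (GridPoint L (2 * (2 * M)))) / 2 + 1), if m' ≤ m'' then ((2 * m'').choose (2 * m') : ℝ) * Real.sqrt 6047 ^ (2 * m'' - 2 * m') * Ng m'' else 0) else 0) ≤ η4) ∧
      (((2 * 3).factorial : ℝ) / (β * (L : ℝ) ^ 2) * (Fintype.card (GridLeg (GridPoint L (2 * (2 * M)))) *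
      ∑ m' ∈ range (Fintype.card (GridLeg (GridPoint L (2 * (2 * M)))) / 2 + 1), if 3 < m' then ((2 * m').choose (2 * 3) : ℝ) * Real.sqrt (klScale klE0 (n + 1) * klIdxMass (n + 1) j') ^ (2 * m' - 2 * 3) * (∑ m'' ∈ range (Fintype.card (GridLeg (GridPoint L (2 * (2 * M)))) / 2 + 1), if m' ≤ m'' then ((2 * m'').choose (2 * m') : ℝ) * Real.sqrt 6047 ^ (2 * m'' - 2 * m') * Ng m'' else 0) else 0) ≤ η6) ∧
      (((2 * 1).factorial : ℝ) / (β * (L : ℝ) ^ 2) * (Fintype.card (GridLeg (GridPoint L (2 * (2 * M)))) *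
      ∑ m' ∈ range (Fintype.card (GridLeg (GridPoint L (2 * (2 * M)))) / 2 + 1), if 1 < m' then ((2 * m').choose (2 * 1) : ℝ) * Real.sqrt (klScale klE0 (n + 1) * klIdxMass (n + 1) j') ^ (2 * m' - 2 * 1) * (∑ m'' ∈ range (Fintype.card (GridLeg (GridPoint L (2 * (2 * M)))) / 2 + 1), if m' ≤ m'' then ((2 * m'').choose (2 * m') : ℝ) * Real.sqrt 6047 ^ (2 * m'' - 2 * m') * Ng m'' else 0) else 0) ≤ η2) ∧
      -- SIZE ROWS (cell STATUS (R253) size model; k3c1-p1 g16 rows 89–92): the kernel numbers in units of `U` / the D-line Gram currency `κD² = Λₙ₊₁·klIdxMass (n+1) j′`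
      0 ≤ M4 ∧ 0 ≤ M6 ∧ 0 ≤ M2 ∧ 0 ≤ η4 ∧ 0 ≤ η6 ∧ 0 ≤ η2 ∧ 0 ≤ c₄ ∧ 0 ≤ c₆ ∧ 0 ≤ c₂ ∧ 0 ≤ e₄ ∧ 0 ≤ e₆ ∧ 0 ≤ e₂ ∧ 0 ≤ sₑ ∧ M4 ≤ c₄ * U ∧ M6 ≤ c₆ * U ∧ M2 ≤ c₂ * U ∧ η4 ≤ e₄ * U * (klScale klE0 (n + 1) * klIdxMass (n + 1) j') ∧ η6 ≤ e₆ * U * (klScale klE0 (n + 1) * klIdxMass (n + 1) j') ∧ η2 ≤ e₂ * U * (klScale klE0 (n + 1) * klIdxMass (n + 1) j') ∧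
      (∀ t ∈ Icc (0 : ℝ) 1, ∀ x y : TorusSite 2 L, ‖Hd j t ![(((omega0 M, y), 0), 0), ((((omega0 M).rev, Qm - y), 1), 0), ((((omega0 M).rev, Qm - x), 1), 1), (((omega0 M, x), 0), 1)]‖ ≤ RH₁ x y) ∧ (∀ t ∈ Icc (0 : ℝ) 1, ∀ x y : TorusSite 2 L, ‖Hd j' t ![(((omega0 M, y), 0), 0), ((((omega0 M).rev, Qm - y), 1), 0), ((((omega0 M).rev, Qm - x), 1), 1), (((omega0 M, x), 0), 1)]‖ ≤ RH₂ x y) ∧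
      (∀ t ∈ Icc (0 : ℝ) 1, ∀ x y : TorusSite 2 L, ‖Hd j t ![(((omega0 M, y), 0), 0), ((((omega0 M).rev, Qm - y), 1), 0), ((((omega0 M).rev, Qm - x), 1), 1), (((omega0 M, x), 0), 1)] - Hd j' t ![(((omega0 M, y), 0), 0), ((((omega0 M).rev, Qm - y), 1), 0), ((((omega0 M).rev, Qm - x), 1), 1), (((omega0 M, x), 0), 1)]‖ ≤ Rhd x y) ∧
      (∀ t ∈ Icc (0 : ℝ) 1, ∀ x y : TorusSite 2 L, ‖∑ z : TorusSite 2 L × MatsubaraIdx M, Br j Qm t z * ((if z.1 ∈ klBall L μ 0 then V j t ![(((omega0 M, z.1), 0), 0), ((((omega0 M).rev, Qm - z.1), 1), 0), ((((omega0 M).rev, Qm - x), 1), 1), (((omega0 M, x), 0), 1)] * V j t ![(((omega0 M, y), 0), 0), ((((omega0 M).rev, Qm - y), 1), 0), ((((omega0 M).rev, Qm - z.1), 1), 1), (((omega0 M, z.1), 0), 1)] else 0) -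
      V j t ![(((z.2, z.1), 0), 0), (((z.2.rev, Qm - z.1), 1), 0), ((((omega0 M).rev, Qm - x), 1), 1), (((omega0 M, x), 0), 1)] * V j t ![(((omega0 M, y), 0), 0), ((((omega0 M).rev, Qm - y), 1), 0), (((z.2.rev, Qm - z.1), 1), 1), (((z.2, z.1), 0), 1)])‖ ≤ RL₁ x y) ∧ (∀ t ∈ Icc (0 : ℝ) 1, ∀ x y : TorusSite 2 L, ‖∑ z : TorusSite 2 L × MatsubaraIdx M, Br j' Qm t z * ((if z.1 ∈ klBall L μ 0 then
      V j' t ![(((omega0 M, z.1), 0), 0), ((((omega0 M).rev, Qm - z.1), 1), 0), ((((omega0 M).rev, Qm - x), 1), 1), (((omega0 M, x), 0), 1)] * V j' t ![(((omega0 M, y), 0), 0), ((((omega0 M).rev, Qm - y), 1), 0), ((((omega0 M).rev, Qm - z.1), 1), 1), (((omega0 M, z.1), 0), 1)] else 0) - V j' t ![(((z.2, z.1), 0), 0), (((z.2.rev, Qm - z.1), 1), 0), ((((omega0 M).rev, Qm - x), 1), 1), (((omega0 M, x), 0), 1)] *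
      V j' t ![(((omega0 M, y), 0), 0), ((((omega0 M).rev, Qm - y), 1), 0), (((z.2.rev, Qm - z.1), 1), 1), (((z.2, z.1), 0), 1)])‖ ≤ RL₂ x y) ∧ (∀ t ∈ Icc (0 : ℝ) 1, ∀ x y : TorusSite 2 L, ‖∑ z : TorusSite 2 L × MatsubaraIdx M, (fun z : TorusSite 2 L × MatsubaraIdx M => -(((((β * (L : ℝ) ^ 2 : ℝ) : ℂ)))⁻¹ * propCT L M β μ (klFlowFrameU L M β U μ (n + 1)) (z.2, z.1) * propCT L M β μ
      (klFlowFrameU L M β U μ (n + 1)) (z.2.rev, Qm - z.1)) * ((((klScale klE0 (n + 1) - klScale klE0 n) * (-Wd t (z.2, z.1) * ((softSymbolCompl L M β μ (klFlowFrameU L M β U μ (n + 1)) (n + 1) j) (z.2.rev, Qm - z.1) - (softSymbolCompl L M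
      β μ (klFlowFrameU L M β U μ (n + 1)) (n + 1) j') (z.2.rev, Qm - z.1)) - ((softSymbolCompl L M β μ (klFlowFrameU L M β U μ (n + 1)) (n + 1) j) (z.2, z.1) - (softSymbolCompl L M β μ (klFlowFrameU L M β U μ (n + 1)) (n + 1) j') (z.2, z.1)) * Wd t (z.2.rev, Qm - z.1))) : ℝ) : ℂ)) z * ((if z.1 ∈ klBall L μ 0 then
      V j t ![(((omega0 M, z.1), 0), 0), ((((omega0 M).rev, Qm - z.1), 1), 0), ((((omega0 M).rev, Qm - x), 1), 1), (((omega0 M, x), 0), 1)] * V j t ![(((omega0 M, y), 0), 0), ((((omega0 M).rev, Qm - y), 1), 0), ((((omega0 M).rev, Qm - z.1), 1), 1), (((omega0 M, z.1), 0), 1)] else 0) - V j t ![(((z.2, z.1), 0), 0), (((z.2.rev, Qm - z.1), 1), 0), ((((omega0 M).rev, Qm - x), 1), 1), (((omega0 M, x), 0), 1)] *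
      V j t ![(((omega0 M, y), 0), 0), ((((omega0 M).rev, Qm - y), 1), 0), (((z.2.rev, Qm - z.1), 1), 1), (((z.2, z.1), 0), 1)])‖ ≤ Rl₁ x y) ∧ (∀ t ∈ Icc (0 : ℝ) 1, ∀ x y : TorusSite 2 L, ‖∑ z : TorusSite 2 L × MatsubaraIdx M, Br j' Qm t z * (((if z.1 ∈ klBall L μ 0 then V j t ![(((omega0 M, z.1), 0), 0), ((((omega0 M).rev, Qm - z.1), 1), 0), ((((omega0 M).rev, Qm - x), 1), 1), (((omega0 M, x), 0), 1)] *
      V j t ![(((omega0 M, y), 0), 0), ((((omega0 M).rev, Qm - y), 1), 0), ((((omega0 M).rev, Qm - z.1), 1), 1), (((omega0 M, z.1), 0), 1)] else 0) - V j t ![(((z.2, z.1), 0), 0), (((z.2.rev, Qm - z.1), 1), 0), ((((omega0 M).rev, Qm - x), 1), 1), (((omega0 M, x), 0), 1)] * V j t ![(((omega0 M, y), 0), 0), ((((omega0 M).rev, Qm - y), 1), 0), (((z.2.rev, Qm - z.1), 1), 1), (((z.2, z.1), 0), 1)]) -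
      ((if z.1 ∈ klBall L μ 0 then V j' t ![(((omega0 M, z.1), 0), 0), ((((omega0 M).rev, Qm - z.1), 1), 0), ((((omega0 M).rev, Qm - x), 1), 1), (((omega0 M, x), 0), 1)] * V j' t ![(((omega0 M, y), 0), 0), ((((omega0 M).rev, Qm - y), 1), 0), ((((omega0 M).rev, Qm - z.1), 1), 1), (((omega0 M, z.1), 0), 1)] else 0) -
      V j' t ![(((z.2, z.1), 0), 0), (((z.2.rev, Qm - z.1), 1), 0), ((((omega0 M).rev, Qm - x), 1), 1), (((omega0 M, x), 0), 1)] * V j' t ![(((omega0 M, y), 0), 0), ((((omega0 M).rev, Qm - y), 1), 0), (((z.2.rev, Qm - z.1), 1), 1), (((z.2, z.1), 0), 1)]))‖ ≤ Rl₂ x y) ∧ (∀ x y, ‖klMemberArrayF L M β U μ n (softSymbolCompl L M β μ (klFlowFrameU L M β U μ n) n j) Qm x y‖ ≤ mA U) ∧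
      -- (F)(i) [k3c2-p2]: majorants of the FRAME SHIFT `K_n → K_(n+1)` of the history members / relative weight (model objects)
      (∀ x y, ‖(((Matrix.of fun k k' : TorusSite 2 L => if k ∈ klBall L μ 0 ∧ k' ∈ klBall L μ 0 then klCovSmearedPairAmplitude L M β U μ (klFlowFrameU L M β U μ (n + 1)) n (softCovOf L M β μ (klFlowFrameU L M β U μ (n + 1)) (softSymbolCompl L M β μ (klFlowFrameU L M β U μ (n + 1)) n j)) Qm k k' else 0) - klMemberArrayF L M β U μ n (softSymbolCompl L M β μ (klFlowFrameU L M β U μ n) n j) Qm) -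
      ((Matrix.of fun k k' : TorusSite 2 L => if k ∈ klBall L μ 0 ∧ k' ∈ klBall L μ 0 then klCovSmearedPairAmplitude L M β U μ (klFlowFrameU L M β U μ (n + 1)) n (softCovOf L M β μ (klFlowFrameU L M β U μ (n + 1)) (softSymbolCompl L M β μ (klFlowFrameU L M β U μ (n + 1)) n j')) Qm k k' else 0) - klMemberArrayF L M β U μ n (softSymbolCompl L M β μ (klFlowFrameU L M β U μ n) n j') Qm)) x y‖ ≤ ηr x y) ∧
      (∀ x y, ‖((Matrix.of fun k k' : TorusSite 2 L => if k ∈ klBall L μ 0 ∧ k' ∈ klBall L μ 0 then klCovSmearedPairAmplitude L M β U μ (klFlowFrameU L M β U μ (n + 1)) n (softCovOf L M β μ (klFlowFrameU L M β U μ (n + 1)) (softSymbolCompl L M β μ (klFlowFrameU L M β U μ (n + 1)) n j)) Qm k k' else 0) - klMemberArrayF L M β U μ n (softSymbolCompl L M β μ (klFlowFrameU L M β U μ n) n j) Qm) x y‖ ≤ η₁ x y) ∧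
      (∀ x y, ‖((Matrix.of fun k k' : TorusSite 2 L => if k ∈ klBall L μ 0 ∧ k' ∈ klBall L μ 0 then klCovSmearedPairAmplitude L M β U μ (klFlowFrameU L M β U μ (n + 1)) n (softCovOf L M β μ (klFlowFrameU L M β U μ (n + 1)) (softSymbolCompl L M β μ (klFlowFrameU L M β U μ (n + 1)) n j')) Qm k k' else 0) - klMemberArrayF L M β U μ n (softSymbolCompl L M β μ (klFlowFrameU L M β U μ n) n j') Qm) x y‖ ≤ η₂ x y) ∧
      (∀ c, ‖(fun p => -(((klTransferWeight L M β μ (klFlowFrameU L M β U μ (n + 1)) n (softSymbolCompl L M β μ (klFlowFrameU L M β U μ (n + 1)) n j) Qm p - klTransferWeight L M β μ (klFlowFrameU L M β U μ (n + 1)) n (softSymbolCompl L M β μ (klFlowFrameU L M β U μ (n + 1)) n j') Qm p : ℝ)) : ℂ)) c -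
      (-(((klTransferWeight L M β μ (klFlowFrameU L M β U μ n) n (softSymbolCompl L M β μ (klFlowFrameU L M β U μ n) n j) Qm c - klTransferWeight L M β μ (klFlowFrameU L M β U μ n) n (softSymbolCompl L M β μ (klFlowFrameU L M β U μ n) n j') Qm c : ℝ)) : ℂ))‖ ≤ d c) ∧
      (∀ x y, (ηr x y + mA U * ∑ c, η₁ x c * (d c + ‖(-(((klTransferWeight L M β μ (klFlowFrameU L M β U μ n) n (softSymbolCompl L M β μ (klFlowFrameU L M β U μ n) n j) Qm c - klTransferWeight L M β μ (klFlowFrameU L M β U μ n) n (softSymbolCompl L M β μ (klFlowFrameU L M β U μ n) n j') Qm c : ℝ)) : ℂ))‖) + mA U * mA U * ∑ c, d c + mA U * ∑ c, ‖(-(((klTransferWeight L M β μ (klFlowFrameU L M β U μ n) n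
      (softSymbolCompl L M β μ (klFlowFrameU L M β U μ n) n j) Qm c - klTransferWeight L M β μ (klFlowFrameU L M β U μ n) n (softSymbolCompl L M β μ (klFlowFrameU L M β U μ n) n j') Qm c : ℝ)) : ℂ))‖ * η₂ c y) ≤ R₀ x y) ∧
      -- a majorant `Φ` of the FUNCTION part of the reorganised analytic majorant (history 4-point rows, localisation rows, (F)(i): owners class #1 / (c) closer / k3c2-p2)
      (∀ x y, R₀ x y + ((klScale klE0 n - klScale klE0 (n + 1)) * (2⁻¹ * Rhd x y) + (Rl₁ x y + Rl₂ x y) + mA U * ∑ c, ((klScale klE0 n - klScale klE0 (n + 1)) * (2⁻¹ * RH₁ x c + ((β * (L : ℝ) ^ 2) ^ 3)⁻¹ * (2 * (M6 * M2 * ((1024 * 15367 : ℝ) / ((klScale klE0 n - klScale klE0 (n + 1)) * ((β * (L : ℝ) ^ 2) ^ 3)⁻¹))))) + RL₁ x c) *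
      (|klTransferWeight L M β μ (klFlowFrameU L M β U μ (n + 1)) (n + 1) (softSymbolCompl L M β μ (klFlowFrameU L M β U μ (n + 1)) (n + 1) j) Qm c - klTransferWeight L M β μ (klFlowFrameU L M β U μ (n + 1)) (n + 1) (softSymbolCompl L M β μ (klFlowFrameU L M β U μ (n + 1)) (n + 1) j') Qm c| +
      (klBubbleMaj L M β μ (klFlowFrameU L M β U μ (n + 1)) (fun k => (softSymbolCompl L M β μ (klFlowFrameU L M β U μ (n + 1)) (n + 1) j) k - (softSymbolCompl L M β μ (klFlowFrameU L M β U μ (n + 1)) (n + 1) j') k) (softSymbolCompl L M β μ (klFlowFrameU L M β U μ (n + 1)) n (n + 1)) Qm c +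
      klBubbleMaj L M β μ (klFlowFrameU L M β U μ (n + 1)) (softSymbolCompl L M β μ (klFlowFrameU L M β U μ (n + 1)) n (n + 1)) (fun k => (softSymbolCompl L M β μ (klFlowFrameU L M β U μ (n + 1)) (n + 1) j) k - (softSymbolCompl L M β μ (klFlowFrameU L M β U μ (n + 1)) (n + 1) j') k) Qm c)) +
      mA U * ∑ c, (|klTransferWeight L M β μ (klFlowFrameU L M β U μ (n + 1)) (n + 1) (softSymbolCompl L M β μ (klFlowFrameU L M β U μ (n + 1)) (n + 1) j) Qm c - klTransferWeight L M β μ (klFlowFrameU L M β U μ (n + 1)) (n + 1) (softSymbolCompl L M β μ (klFlowFrameU L M β U μ (n + 1)) (n + 1) j') Qm c| +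
      (klBubbleMaj L M β μ (klFlowFrameU L M β U μ (n + 1)) (fun k => (softSymbolCompl L M β μ (klFlowFrameU L M β U μ (n + 1)) (n + 1) j) k - (softSymbolCompl L M β μ (klFlowFrameU L M β U μ (n + 1)) (n + 1) j') k) (softSymbolCompl L M β μ (klFlowFrameU L M β U μ (n + 1)) n (n + 1)) Qm c +
      klBubbleMaj L M β μ (klFlowFrameU L M β U μ (n + 1)) (softSymbolCompl L M β μ (klFlowFrameU L M β U μ (n + 1)) n (n + 1)) (fun k => (softSymbolCompl L M β μ (klFlowFrameU L M β U μ (n + 1)) (n + 1) j) k - (softSymbolCompl L M β μ (klFlowFrameU L M β U μ (n + 1)) (n + 1) j') k) Qm c)) * ((klScale klE0 n - klScale klE0 (n + 1)) * (2⁻¹ * RH₂ c y + ((β * (L : ℝ) ^ 2) ^ 3)⁻¹ * (2 * (M6 * M2 * ((1024 * 15367 : ℝ) / ((klScale klE0 n - klScale klE0 (n + 1)) * ((β * (L : ℝ) ^ 2) ^ 3)⁻¹))))) + RL₂ c y)) ≤ Φ x y) ∧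
      -- (B1) OWNERS' SHARE (φ = 1/2, cell STATUS (R243)): the dressed FUNCTION-part majorant `𝒟[Φ](k,k′)` against the frame slack of the inherited bar plus HALF of three fifths of the ROOM
      (∀ k ∈ klBall L μ 0, ∀ k' ∈ klBall L μ 0, Φ k k' + ∑ c, Φ k c * ρ j' Qm c * (3 / 2 * mA U) + ∑ a', 3 / 2 * mA U * ρ j Qm a' * Φ a' k' + ∑ a', ∑ c, 3 / 2 * mA U * ρ j Qm a' * Φ a' c * ρ j' Qm c * (3 / 2 * mA U) ≤ θ * (((2 : ℝ) ^ (n + 2))⁻¹ * transferBarRelIdx L klEngGeoTh P r β U n j' Qm k k' + 2⁻¹ * (3 / 5 * (klIdxPrefactor r (n + 1) * ((P.Klam * U) ^ 2 *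
      ((min (klTorusNorm L (k - k') / klScale klE0 (n + 1)) (klScale klE0 (n + 1) / klTorusNorm L (k - k')) + min (klTorusNorm L (k + k' - Qm) / klScale klE0 (n + 1)) (klScale klE0 (n + 1) / klTorusNorm L (k + k' - Qm)) + ((2 : ℝ) ^ n)⁻¹ + 3 * ((L : ℝ))⁻¹) * klIdxMass n j' + ((4 : ℝ) ^ (n + 1))⁻¹ * klIdxOverlap (n + 1) j') +
      ((P.Klam * |U|) ^ 3 * ((2 : ℝ) ^ n)⁻¹ + 3 * thermalBar klEngGeoTh P U β (n + 1)) * klIdxMass n j'))))) ∧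
      -- (T2)/(T3) THRESHOLD rows of the `min`-slot coefficients (rows (B2)/(B3) discharged by `klbd_scalarRow_direct/crossed_of_sizes`, k3c1-p1 g16 row 89)
      (1 ≤ n → klTS * (1156 * c₄ ^ 2 + 2 ^ 28 * ((4 : ℝ) ^ n)⁻¹ * (e₄ * c₄)) ≤ 9 / 20 * (θ * (r * P.Klam ^ 2))) ∧ (1 ≤ n → klTS * (2712 * c₄ ^ 2 + 2 ^ 27 * ((4 : ℝ) ^ n)⁻¹ * (e₄ * c₄)) ≤ 9 / 20 * (θ * (r * P.Klam ^ 2))) ∧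
      -- (T2p)/(T3p) THRESHOLD rows AT THE PINNED PAIR ((B2″)/(B3″) discharged by `klpp_scalarRow_direct/crossed_pinned_of_sizes`, k3c1-p1 g17)
      (1 ≤ n → j' = n + 1 → klTS * (3081 * c₄ ^ 2 + 2 ^ 28 * ((4 : ℝ) ^ n)⁻¹ * (e₄ * c₄)) + 4 / 15367 * (tD * P.Klam ^ 2) ≤ 9 / 20 * (θ * (r * P.Klam ^ 2))) ∧ (1 ≤ n → j' = n + 1 → klTS * (6161 * c₄ ^ 2 + 2 ^ 27 * ((4 : ℝ) ^ n)⁻¹ * (e₄ * c₄)) + 4 / 15367 * (tX * P.Klam ^ 2) ≤ 9 / 20 * (θ * (r * P.Klam ^ 2))) ∧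
      -- (T4) THRESHOLD rows of the constant part (row (B4) discharged at n = 0 / in the interior / at the crossed top edge by rows 90/91/92; `Ish := 2n+8`, `Iw := 2n+10`)
      (n = 0 → (3220 * sₑ + 136) * c₄ ^ 2 + 2147 * sₑ * (c₆ * c₂) + 3100000 * (e₄ * c₄) + 1031000 * (e₆ * c₂ + c₆ * e₂) ≤ 9 / 20 * (θ * (r * P.Klam ^ 2))) ∧ (1 ≤ n → n + 2 ≤ j' → 608 * (klTS * c₄ ^ 2) + 1 / 3 * c₄ ^ 2 + 860000 * (klTS * c₄ * e₄) + 1550000 * (c₄ * e₄) + 516000 * (c₂ * e₆ + c₆ * e₂) ≤ 9 / 20 * (θ * (r * P.Klam ^ 2))) ∧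
      (1 ≤ n → n + 2 ≤ j' → ¬(n + 3 ≤ nScales β) → 1073 * (sₑ * c₄ ^ 2) ≤ 27 / 80 * (θ * (r * (klEngGeoTh.CF * P.Klam ^ 2)))) ∧
      -- the EDGE SOFT MASS of the pair's D-line at scale n in index-mass units («(X).3-D-EDGE» pricing, k3c2-p2)
      (0 ≤ klSoftMass L M β μ (klFlowFrameU L M β U μ (n + 1)) n (fun p => softSymbolCompl L M β μ (klFlowFrameU L M β U μ (n + 1)) (n + 1) j p - softSymbolCompl L M β μ (klFlowFrameU L M β U μ (n + 1)) (n + 1) j' p) ∧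
      klSoftMass L M β μ (klFlowFrameU L M β U μ (n + 1)) n (fun p => softSymbolCompl L M β μ (klFlowFrameU L M β U μ (n + 1)) (n + 1) j p - softSymbolCompl L M β μ (klFlowFrameU L M β U μ (n + 1)) (n + 1) j' p) ≤ sₑ * klIdxMass n j') ∧
      -- (T4p) the PINNED pair's (B4″) from sizes: thresholds for the `2⁻ⁿ` slot, the `3/L` slot, the thermal slot and (top edge) the flat soft mass — `klpp_scalarRow_const_pinned(_top)_of_sizes`
      (1 ≤ n → j' = n + 1 → (2520966 : ℝ) * (klTS * c₄ ^ 2) + (3303243395 : ℝ) * (klTS * c₄ * e₄) + (1207 : ℝ) * (c₄ ^ 2) + (5939464501 : ℝ) * (c₄ * e₄) + (1979821501 : ℝ) * (c₆ * e₂) + (1979821501 : ℝ) * (c₂ * e₆) + (131 / 1000 : ℝ) * (P.Klam ^ 2 * zD) + (21 / 20 : ℝ) * (P.Klam ^ 2 * wD) + (909 / 100000 : ℝ) * (P.Klam ^ 2 * tD) + (131 / 1000 : ℝ) * (P.Klam ^ 2 * zX) + (21 / 20 : ℝ) * (P.Klam ^ 2 * wX) + (909 / 100000 : ℝ) * (P.Klam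 ^ 2 * tX) + (131 / 500 : ℝ) * (P.Klam ^ 2 * bP) ≤ 9 / 20 * (15367 / 4) * (θ * (r * P.Klam ^ 2))) ∧ (1 ≤ n → j' = n + 1 → (21 / 20 : ℝ) * (P.Klam ^ 2 * lD) + (21 / 20 : ℝ) * (P.Klam ^ 2 * lX) ≤ 27 / 20 * (15367 / 4) * (θ * (r * P.Klam ^ 2))) ∧
      (1 ≤ n → j' = n + 1 → (21 / 20 : ℝ) * (P.Klam ^ 2 * hD) + (21 / 20 : ℝ) * (P.Klam ^ 2 * hX) ≤ 27 / 40 * (15367 / 4) * (θ * (r * (klEngGeoTh.CF * P.Klam ^ 2)))) ∧ (1 ≤ n → j' = n + 1 → ¬(n + 3 ≤ nScales β) → (4122750 : ℝ) * (sₑ * c₄ ^ 2) ≤ 27 / 160 * (15367 / 4) * (θ * (r * (klEngGeoTh.CF * P.Klam ^ 2))))) ∧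
      -- `hexport`
      (klEngGeo14.WF → ∀ Q : EngConsts, (klEngQ7 P R).IsRaiseOf Q → ∀ cc : ℝ, 0 < cc → cc ≤ klEngC₃6 P R →
      ∀ μ ∈ klWindowC, ∀ U : ℝ, 0 < U → U ≤ klEngU₀10 P R cc → U ≤ u Q cc → ∀ β : ℝ, klBetaMin ≤ β → β ≤ Real.exp (cc / U ^ 2) → ∀ (L M : ℕ) [NeZero L] [NeZero M], klEngL₄ P R β U ≤ L → klEngM₃ β U L ≤ M → ∀ n : ℕ, n ≤ nScales β + 1 → IsKLRegime U cc (-((n : ℕ) : ℤ)) → HistP klPredsV17F2 L M klEngGeo14 P Q R β U μ 0 (n) → FrameOK R U (nScales β) μ (klFlowFrameU L M β U μ (n)) →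
      (∀ j ≤ n, LevelsUExportMixedAt L M (klCU2 P R (klEngQ7 P R)) P β U μ j) → ∀ j' : ℕ, n ≤ j' → j' ≤ nScales β + 1 → ∀ Qm : TorusSite 2 L, ∀ x y, ‖klMemberArrayF L M β U μ n (softSymbolCompl L M β μ (klFlowFrameU L M β U μ n) n j') Qm x y‖ ≤ mA U))
    (hX3 : ∀ (P : SplitConsts) (R : RenConsts), P.WF → R.WF2 →
      ∃ e : (ℕ → ℝ) × (EngConsts → ℝ → ℝ), IsSpaceMomPkg5Z R e ∧ TwoLegSpaceMomentsStep5 P R (klEngQ7 P R) klEngGeo14 e.1 e.2) :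
    ∀ (P : SplitConsts) (R : RenConsts), P.WF → R.WF2 → (∃ e : (ℕ → ℝ) × ℝ × (EngConsts → ℝ → ℝ), IsExportPkg2 e ∧ LevelsUStep2 P R (klEngQ7 P R) e.1 e.2.2) ∧
      (∃ e : ℝ × (EngConsts → ℝ → ℝ), IsTransferPkg8 e ∧ PairTransferStep7 P R (klEngQ7 P R) klEngGeo14 klEngGeoTh e.1 e.2) ∧
      (∃ e : (ℕ → ℝ) × (EngConsts → ℝ → ℝ), IsSpaceMomPkg5Z R e ∧ TwoLegSpaceMomentsStep5 P R (klEngQ7 P R) klEngGeo14 e.1 e.2) := by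
  intro P R hP hR
  refine ⟨hX1 P R hP hR, ?_, hX3 P R hP hR⟩
  obtain ⟨r, θ, u, mA, ⟨hr, hrc, hu, hθ0, hθ⟩, hmA, hbase, hsucc, hexport⟩ := h5 P R hP hR
  obtain ⟨e, he, hstep, -⟩ :=
    KLRegimeSplit.exists_isTransferPkg8_of_analytic_resolved_sized_klTS_pinned2sb_unguarded (P := P) (R := R) (Q₀ := klEngQ7 P R)
      (G := klEngGeo14) (Gth := klEngGeoTh) (r := r) (θ := θ) (u := u) mA hR klEngGeoTh_CF_nonneg (zero_le_one.trans hP.1) hr hrc hu hθ0 hθ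
      (fun U μ β hμ => klFrameOK_zeroC hR.wf U (nScales β) hμ) hmA hbase hsucc hexport
  exact ⟨e, he, hstep⟩

set_option maxHeartbeats 3200000 in -- long binder lists
/-- **ROW (X) BY TYPE over the SB one-call, `r := klCTcap8`, `θ := 1/5`** (data `u mA`). ⊢ row (X) verbatim. [cite: BenfattoGiulianiMastropietro2006, §2.4 (2.36), §3 Thm 3.1] -/
theorem stub_engine_exports_of_class5RowsCapSB
    (hX1 : ∀ (P : SplitConsts) (R : RenConsts), P.WF → R.WF2 →
      ∃ e : (ℕ → ℝ) × ℝ × (EngConsts → ℝ → ℝ), IsExportPkg2 e ∧ LevelsUStep2 P R (klEngQ7 P R) e.1 e.2.2)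
    (h5 : ∀ (P : SplitConsts) (R : RenConsts), P.WF → R.WF2 →
      ∃ (u : EngConsts → ℝ → ℝ) (mA : ℝ → ℝ), (∀ Q cc, 0 < u Q cc) ∧
      -- `hmA`
      (∀ (Q : EngConsts) (cc U : ℝ), 0 < U → U ≤ u Q cc → 0 ≤ mA U ∧ mA U * ((2 : ℝ) ^ 10 * 15367) ≤ 1 / 3) ∧
      -- `hbase` (SB: a priori rows + the CLOSED second-order scalar row `160·ms·U² + 2²⁰/12108³·CV·ΘC²·ms·U³ + 4(mA U)²ms ≤ θ r (KlamU)² ms`)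
      (klEngGeo14.WF → ∀ Q : EngConsts, (klEngQ7 P R).IsRaiseOf Q → ∀ cc : ℝ, 0 < cc → cc ≤ klEngC₃6 P R → ∀ μ ∈ klWindowC, ∀ U : ℝ, 0 < U → U ≤ klEngU₀10 P R cc → U ≤ u Q cc → ∀ β : ℝ, klBetaMin ≤ β → β ≤ Real.exp (cc / U ^ 2) → ∀ (L M : ℕ) [NeZero L] [NeZero M], klEngL₄ P R β U ≤ L → klEngM₃ β U L ≤ M →
      0 ≤ nScales β + 1 → IsKLRegime U cc (-((0 : ℕ) : ℤ)) → HistP klPredsV17F2 L M klEngGeo14 P Q R β U μ 0 0 → FrameOK R U (nScales β) μ (klFlowFrameU L M β U μ 0) → (∀ j ≤ 0, LevelsUExportMixedAt L M (klCU2 P R (klEngQ7 P R)) P β U μ j) → ∀ j j' : ℕ, 0 ≤ j' → j' ≤ j → j ≤ nScales β + 1 → ∀ Qm : TorusSite 2 L,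
      -- BASE CLOSED at scale 0, SECOND ORDER EXPLICIT (k3c5-p1 g22 `klmf_baseData_of_scaleZero_secondOrder`; re-key k3c1-p1 g23): the two a priori rows
      -- [class #1] and ONE scalar inequality of the depth `j′` (`klTransferC R` = k3c2-p1 g5's closed scale-0 transfer constant)
      (∀ x y, ‖klMemberArrayF L M β U μ 0 (softSymbolCompl L M β μ (klFlowFrameU L M β U μ 0) 0 j) Qm x y‖ ≤ mA U) ∧ (∀ x y, ‖klMemberArrayF L M β U μ 0 (softSymbolCompl L M β μ (klFlowFrameU L M β U μ 0) 0 j') Qm x y‖ ≤ mA U) ∧ (160 * klIdxMass 0 j' * U ^ 2 + 2 ^ 20 / 12108 ^ 3 * klScaleZeroCV R * klScaleZeroThetaC R ^ 2 * klIdxMass 0 j' * U ^ 3) +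
      4 * (mA U * mA U) * klIdxMass 0 j' ≤ (1 / 5 : ℝ) * (klCTcap8 * ((P.Klam * U) ^ 2 * klIdxMass 0 j'))) ∧
      -- `hsucc`
      (klEngGeo14.WF → ∀ Q : EngConsts, (klEngQ7 P R).IsRaiseOf Q →
      ∀ cc : ℝ, 0 < cc → cc ≤ klEngC₃6 P R → ∀ μ ∈ klWindowC, ∀ U : ℝ, 0 < U → U ≤ klEngU₀10 P R cc → U ≤ u Q cc → ∀ β : ℝ, klBetaMin ≤ β → β ≤ Real.exp (cc / U ^ 2) → ∀ (L M : ℕ) [NeZero L] [NeZero M], klEngL₄ P R β U ≤ L → klEngM₃ β U L ≤ M → ∀ n : ℕ, n + 1 ≤ nScales β + 1 → IsKLRegime U cc (-((n + 1 : ℕ) : ℤ)) → HistP klPredsV17F2 L M klEngGeo14 P Q R β U μ 0 (n + 1) →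
      FrameOK R U (nScales β) μ (klFlowFrameU L M β U μ (n + 1)) → (∀ j ≤ n + 1, LevelsUExportMixedAt L M (klCU2 P R (klEngQ7 P R)) P β U μ j) → (∀ Λ ∈ Icc (klScale klE0 (n + 1)) (klScale klE0 n), hubbardEffPartitionFnCT L M β U μ 0 (klFlowFrameU L M β U μ (n + 1)) Λ ≠ 0) ∧ ∀ (A A' : ℕ → TorusSite 2 L → ℝ → Matrix (TorusSite 2 L) (TorusSite 2 L) ℂ) (b b' : ℕ → TorusSite 2 L → ℝ → TorusSite 2 L → ℂ)
      (a : ℕ → ℕ → TorusSite 2 L → ℝ → TorusSite 2 L → ℂ) (ρ : ℕ → TorusSite 2 L → TorusSite 2 L → ℝ) (V : ℕ → ℝ → (Fin 4 → HubbardFieldIdx L M) → ℂ) (V6 : ℕ → ℝ → (Fin 6 → HubbardFieldIdx L M) → ℂ) (Sg : ℕ → ℝ → FreqMomentum L M → Fin 2 → ℂ) (Hd : ℕ → ℝ → (Fin 4 → HubbardFieldIdx L M) → ℂ) (Φ : ℕ → ℝ → FreqMomentum L M → ℝ) (Wd : ℝ →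
      FreqMomentum L M → ℝ) (Br : ℕ → TorusSite 2 L → ℝ → TorusSite 2 L × MatsubaraIdx M → ℂ), (A = fun j Qm t => Matrix.of fun k k' : TorusSite 2 L => if k ∈ klBall L μ 0 ∧ k' ∈ klBall L μ 0 then vertexFn L M β (gaussConv ℂ
      (softCovOf L M β μ (klFlowFrameU L M β U μ (n + 1)) (softSymbolCompl L M β μ (klFlowFrameU L M β U μ (n + 1)) (n + 1) j) + hubbardCovAboveCT L M β μ 0 (klFlowFrameU L M β U μ (n + 1)) (klScale klE0 (n + 1)) - hubbardCovAboveCT L M β μ 0 (klFlowFrameU L M β U μ (n + 1)) (klScale klE0 n + t * (klScale klE0 (n + 1) - klScale klE0 n)))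
      (hubbardEffectiveActionCT L M β U μ 0 (klFlowFrameU L M β U μ (n + 1)) (klScale klE0 n + t * (klScale klE0 (n + 1) - klScale klE0 n)))) 4 ![(((omega0 M, k'), 0), 0), ((((omega0 M).rev, Qm - k'), 1), 0), ((((omega0 M).rev, Qm - k), 1), 1), (((omega0 M, k), 0), 1)] else 0) → (A' = fun j Qm t => Matrix.of fun k k' : TorusSite 2 L => if k ∈ klBall L μ 0 ∧ k' ∈ klBall L μ 0 then
      (klScale klE0 (n + 1) - klScale klE0 n) • -((2 : ℂ)⁻¹ * vertexFn L M β (gaussConv ℂ (softCovOf L M β μ (klFlowFrameU L M β U μ (n + 1)) (softSymbolCompl L M β μ (klFlowFrameU L M β U μ (n + 1)) (n + 1) j) + hubbardCovAboveCT L M β μ 0 (klFlowFrameU L M β U μ (n + 1)) (klScale klE0 (n + 1)) -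
      hubbardCovAboveCT L M β μ 0 (klFlowFrameU L M β U μ (n + 1)) (klScale klE0 n + t * (klScale klE0 (n + 1) - klScale klE0 n))) (grassmannDerivPairing ℂ (Matrix.of fun X Y : HubbardFieldIdx L M => deriv (fun Λ'' : ℝ => hubbardCovAboveCT L M β μ 0 (klFlowFrameU L M β U μ (n + 1)) Λ'' X Y) (klScale klE0 n + t * (klScale klE0 (n + 1) - klScale klE0 n)))
      (hubbardEffectiveActionCT L M β U μ 0 (klFlowFrameU L M β U μ (n + 1)) (klScale klE0 n + t * (klScale klE0 (n + 1) - klScale klE0 n))) (hubbardEffectiveActionCT L M β U μ 0 (klFlowFrameU L M β U μ (n + 1)) (klScale klE0 n + t * (klScale klE0 (n + 1) - klScale klE0 n))))) 4 ![(((omega0 M, k'), 0), 0), ((((omega0 M).rev, Qm - k'), 1), 0), ((((omega0 M).rev, Qm - k), 1), 1), (((omega0 M, k), 0), 1)]) else 0) →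
      (b = fun j Qm t p => -((klBubbleMass L M β μ (klFlowFrameU L M β U μ (n + 1)) (fun k => (softSymbolCompl L M β μ (klFlowFrameU L M β U μ (n + 1)) (n + 1) j) k + (hubbardCutoffWeightCT L M β μ (klFlowFrameU L M β U μ (n + 1)) (klScale klE0 (n + 1)) k - hubbardCutoffWeightCT L M β μ (klFlowFrameU L M β U μ (n + 1)) (klScale klE0 n + t * (klScale klE0 (n + 1) - klScale klE0 n)) k))
      (fun k => (softSymbolCompl L M β μ (klFlowFrameU L M β U μ (n + 1)) (n + 1) j) k + (hubbardCutoffWeightCT L M β μ (klFlowFrameU L M β U μ (n + 1)) (klScale klE0 (n + 1)) k - hubbardCutoffWeightCT L M β μ (klFlowFrameU L M β U μ (n + 1)) (klScale klE0 n + t * (klScale klE0 (n + 1) - klScale klE0 n)) k)) Qm p : ℝ) : ℂ)) → (b' = fun j Qm t p => (((klScale klE0 (n + 1) - klScale klE0 n) *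
      (klBubbleMass L M β μ (klFlowFrameU L M β U μ (n + 1)) (fun k => deriv (fun Λ' => hubbardCutoffWeightCT L M β μ (klFlowFrameU L M β U μ (n + 1)) Λ' k) (klScale klE0 n + t * (klScale klE0 (n + 1) - klScale klE0 n))) (fun k => (softSymbolCompl L M β μ (klFlowFrameU L M β U μ (n + 1)) (n + 1) j) k + (hubbardCutoffWeightCT L M β μ (klFlowFrameU L M β U μ (n + 1)) (klScale klE0 (n + 1)) k -
      hubbardCutoffWeightCT L M β μ (klFlowFrameU L M β U μ (n + 1)) (klScale klE0 n + t * (klScale klE0 (n + 1) - klScale klE0 n)) k)) Qm p + klBubbleMass L M β μ (klFlowFrameU L M β U μ (n + 1)) (fun k => (softSymbolCompl L M β μ (klFlowFrameU L M β U μ (n + 1)) (n + 1) j) k + (hubbardCutoffWeightCT L M β μ (klFlowFrameU L M β U μ (n + 1)) (klScale klE0 (n + 1)) k -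
      hubbardCutoffWeightCT L M β μ (klFlowFrameU L M β U μ (n + 1)) (klScale klE0 n + t * (klScale klE0 (n + 1) - klScale klE0 n)) k)) (fun k => deriv (fun Λ' => hubbardCutoffWeightCT L M β μ (klFlowFrameU L M β U μ (n + 1)) Λ' k) (klScale klE0 n + t * (klScale klE0 (n + 1) - klScale klE0 n))) Qm p) : ℝ) : ℂ)) → (a = fun j j' Qm t p => (b j Qm t p - b j' Qm t p) +
      (-(((klTransferWeight L M β μ (klFlowFrameU L M β U μ (n + 1)) (n + 1) (softSymbolCompl L M β μ (klFlowFrameU L M β U μ (n + 1)) (n + 1) j) Qm p - klTransferWeight L M β μ (klFlowFrameU L M β U μ (n + 1)) (n + 1) (softSymbolCompl L M β μ (klFlowFrameU L M β U μ (n + 1)) (n + 1) j') Qm p : ℝ)) : ℂ) - (b j Qm 1 p - b j' Qm 1 p))) →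
      (ρ = fun j Qm c => klRungProfile L M β μ (klFlowFrameU L M β U μ (n + 1)) n (softSymbolCompl L M β μ (klFlowFrameU L M β U μ (n + 1)) (n + 1) j) Qm c) → (V = fun j t X => vertexFn L M β (gaussConv ℂ (softCovOf L M β μ (klFlowFrameU L M β U μ (n + 1)) (softSymbolCompl L M β μ (klFlowFrameU L M β U μ (n + 1)) (n + 1) j) + hubbardCovAboveCT L M β μ 0 (klFlowFrameU L M β U μ (n + 1)) (klScale
      klE0 (n + 1)) - hubbardCovAboveCT L M β μ 0 (klFlowFrameU L M β U μ (n + 1)) (klScale klE0 n + t * (klScale klE0 (n + 1) - klScale klE0 n))) (hubbardEffectiveActionCT L M β U μ 0 (klFlowFrameU L M β U μ (n + 1)) (klScale klE0 n + t * (klScale klE0 (n + 1) - klScale klE0 n)))) 4 X) →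
      (V6 = fun j t X => vertexFn L M β (gaussConv ℂ (softCovOf L M β μ (klFlowFrameU L M β U μ (n + 1)) (softSymbolCompl L M β μ (klFlowFrameU L M β U μ (n + 1)) (n + 1) j) + hubbardCovAboveCT L M β μ 0 (klFlowFrameU L M β U μ (n + 1)) (klScale
      klE0 (n + 1)) - hubbardCovAboveCT L M β μ 0 (klFlowFrameU L M β U μ (n + 1)) (klScale klE0 n + t * (klScale klE0 (n + 1) - klScale klE0 n))) (hubbardEffectiveActionCT L M β U μ 0 (klFlowFrameU L M β U μ (n + 1)) (klScale klE0 n + t * (klScale klE0 (n + 1) - klScale klE0 n)))) 6 X) →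
      (Sg = fun j t p σ => selfEnergy L M β (gaussConv ℂ (softCovOf L M β μ (klFlowFrameU L M β U μ (n + 1)) (softSymbolCompl L M β μ (klFlowFrameU L M β U μ (n + 1)) (n + 1) j) + hubbardCovAboveCT L M β μ 0 (klFlowFrameU L M β U μ (n + 1))
      (klScale klE0 (n + 1)) - hubbardCovAboveCT L M β μ 0 (klFlowFrameU L M β U μ (n + 1)) (klScale klE0 n + t * (klScale klE0 (n + 1) - klScale klE0 n))) (hubbardEffectiveActionCT L M β U μ 0 (klFlowFrameU L M β U μ (n + 1)) (klScale klE0 n + t * (klScale klE0 (n + 1) - klScale klE0 n)))) p σ) →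
      (Hd = fun j t X => vertexFn L M β (dblFold ℂ (grassmannLaplacian ℂ (crossCov ℂ (Matrix.of fun X Y : HubbardFieldIdx L M => deriv (fun Λ' : ℝ => hubbardCovAboveCT L M β μ 0 (klFlowFrameU L M β U μ (n + 1)) Λ' X Y) (klScale klE0 n + t *
      (klScale klE0 (n + 1) - klScale klE0 n)))) ((gaussConv ℂ (crossCov ℂ (softCovOf L M β μ (klFlowFrameU L M β U μ (n + 1)) (softSymbolCompl L M β μ (klFlowFrameU L M β U μ (n + 1)) (n + 1) j) + hubbardCovAboveCT L M β μ 0 (klFlowFrameU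
      L M β U μ (n + 1)) (klScale klE0 (n + 1)) - hubbardCovAboveCT L M β μ 0 (klFlowFrameU L M β U μ (n + 1)) (klScale klE0 n + t * (klScale klE0 (n + 1) - klScale klE0 n)))) - grassmannLaplacian ℂ (crossCov ℂ (softCovOf L M β μ
      (klFlowFrameU L M β U μ (n + 1)) (softSymbolCompl L M β μ (klFlowFrameU L M β U μ (n + 1)) (n + 1) j) + hubbardCovAboveCT L M β μ 0 (klFlowFrameU L M β U μ (n + 1)) (klScale klE0 (n + 1)) - hubbardCovAboveCT L M β μ 0 (klFlowFrameU L
      M β U μ (n + 1)) (klScale klE0 n + t * (klScale klE0 (n + 1) - klScale klE0 n))))) (dblCopy ℂ 0 (gaussConv ℂ (softCovOf L M β μ (klFlowFrameU L M β U μ (n + 1)) (softSymbolCompl L M β μ (klFlowFrameU L M β U μ (n + 1)) (n + 1) j) +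
      hubbardCovAboveCT L M β μ 0 (klFlowFrameU L M β U μ (n + 1)) (klScale klE0 (n + 1)) - hubbardCovAboveCT L M β μ 0 (klFlowFrameU L M β U μ (n + 1)) (klScale klE0 n + t * (klScale klE0 (n + 1) - klScale klE0 n)))
      (hubbardEffectiveActionCT L M β U μ 0 (klFlowFrameU L M β U μ (n + 1)) (klScale klE0 n + t * (klScale klE0 (n + 1) - klScale klE0 n)))) * dblCopy ℂ 1 (gaussConv ℂ (softCovOf L M β μ (klFlowFrameU L M β U μ (n + 1)) (softSymbolCompl L
      M β μ (klFlowFrameU L M β U μ (n + 1)) (n + 1) j) + hubbardCovAboveCT L M β μ 0 (klFlowFrameU L M β U μ (n + 1)) (klScale klE0 (n + 1)) - hubbardCovAboveCT L M β μ 0 (klFlowFrameU L M β U μ (n + 1)) (klScale klE0 n + t * (klScale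
      klE0 (n + 1) - klScale klE0 n))) (hubbardEffectiveActionCT L M β U μ 0 (klFlowFrameU L M β U μ (n + 1)) (klScale klE0 n + t * (klScale klE0 (n + 1) - klScale klE0 n)))))))) 4 X) →
      (Φ = fun j t k => (softSymbolCompl L M β μ (klFlowFrameU L M β U μ (n + 1)) (n + 1) j) k + (hubbardCutoffWeightCT L M β μ (klFlowFrameU L M β U μ (n + 1)) (klScale klE0 (n + 1)) k - hubbardCutoffWeightCT L M β μ (klFlowFrameU L M β U μ (n + 1)) (klScale klE0 n + t * (klScale klE0 (n + 1) - klScale klE0 n)) k)) →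
      (Wd = fun t k => deriv (fun Λ' : ℝ => hubbardCutoffWeightCT L M β μ (klFlowFrameU L M β U μ (n + 1)) Λ' k) (klScale klE0 n + t * (klScale klE0 (n + 1) - klScale klE0 n))) → (Br = fun j Qm t z => -(((((β * (L : ℝ) ^ 2 : ℝ) : ℂ)))⁻¹ * propCT L M β μ (klFlowFrameU L M β U μ (n + 1)) (z.2, z.1) * propCT L M β μ (klFlowFrameU L M β U μ (n + 1)) (z.2.rev, Qm - z.1)) *
      ((((klScale klE0 (n + 1) - klScale klE0 n) * (-Wd t (z.2, z.1) * Φ j t (z.2.rev, Qm - z.1) - Φ j t (z.2, z.1) * Wd t (z.2.rev, Qm - z.1))) : ℝ) : ℂ)) → ∀ j j' : ℕ, n + 1 ≤ j' → j' ≤ j → j ≤ nScales β + 1 → ∀ Qm : TorusSite 2 L, ∃ (ηr η₁ η₂ R₀ Φ : TorusSite 2 L → TorusSite 2 L → ℝ) (d : TorusSite 2 L → ℝ) (M4 M6 M2 η4 η6 η2 c₄ c₆ c₂ e₄ e₆ e₂ sₑ zD hD wD lD tD zX hX wX lX tX bP : ℝ)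
      (RH₁ RH₂ Rhd RL₁ RL₂ Rl₁ Rl₂ : TorusSite 2 L → TorusSite 2 L → ℝ) (Ng : ℕ → ℝ), (∀ t ∈ Icc (0 : ℝ) 1, ∀ x y, ‖A j Qm t x y‖ ≤ mA U) ∧ (∀ t ∈ Icc (0 : ℝ) 1, ∀ x y, ‖A j' Qm t x y‖ ≤ mA U) ∧
      -- class-#1 kernel inputs IN GRID-NORMS CURRENCY (rows 48/51): the pinned GRID kernel norms `Ng` of `Gg(t) = effAction (SᵀC^K_(Λ(t))S)(V_N + 𝒩_(K,N))` and the six binomial numbers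
      -- they produce (γ := √6047, κD := √(Λ_(n+1)·klIdxMass (n+1) j′) discharged); `M4 M6 M2 η4 η6 η2` are the names the `Ran` row uses
      (∀ m', 0 ≤ Ng m') ∧ (0 ≤ zD ∧ 0 ≤ hD ∧ 0 ≤ wD ∧ 0 ≤ lD ∧ 0 ≤ tD ∧ 0 ≤ zX ∧ 0 ≤ hX ∧ 0 ≤ wX ∧ 0 ≤ lX ∧ 0 ≤ tX ∧ 0 ≤ bP) ∧
      -- «88b» THE PINNED PAIR (`1 ≤ n`, `j′ = n+1`): the SIGNED direct/crossed `D`-rows in the forward windows, five-slot scalar form (binders `zD … tX`; split3 door ∘ slots)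
      (1 ≤ n → j' = n + 1 → ∀ t ∈ Icc (0 : ℝ) 1, ∀ x y : TorusSite 2 L, (4 + 8 / 3 * R.Gfr 1 * U ^ 2) * klTorusNorm L (x - y) < klScale klE0 (n + 1) / 8 → ((klScale klE0 n - klScale klE0 (n + 1)) * ((β * (L : ℝ) ^ 2) ^ 3)⁻¹) * ‖(∑ p : FreqMomentum L M, ∑ σ : Fin 2, ∑ p' : FreqMomentum L M, if matsubaraInt M p'.1 + matsubaraInt M (omega0 M) = matsubaraInt M p.1 + matsubaraInt M (omega0 M) ∧ p'.2 = p.2 + x - y then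
      ((((((((softSymbolCompl L M β μ (klFlowFrameU L M β U μ (n + 1)) (n + 1) j) p - (softSymbolCompl L M β μ (klFlowFrameU L M β U μ (n + 1)) (n + 1) j') p)) : ℝ) : ℂ) * (((β * (L : ℝ) ^ 2 : ℝ) : ℂ) * propCT L M β μ (klFlowFrameU L M β U μ (n + 1)) p)) * ((((Wd t p') : ℝ) : ℂ) * (((β * (L : ℝ) ^ 2 : ℝ) : ℂ) * propCT L M β μ
      (klFlowFrameU L M β U μ (n + 1)) p'))) + (((((Wd t p) : ℝ) : ℂ) * (((β * (L : ℝ) ^ 2 : ℝ) : ℂ) * propCT L M β μ (klFlowFrameU L M β U μ (n + 1)) p)) * ((((((softSymbolCompl L M β μ (klFlowFrameU L M β U μ (n + 1)) (n + 1) j) p' - (softSymbolCompl L M β μ (klFlowFrameU L M β U μ (n + 1)) (n + 1) j') p')) : ℝ) :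
      ℂ) * (((β * (L : ℝ) ^ 2 : ℝ) : ℂ) * propCT L M β μ (klFlowFrameU L M β U μ (n + 1)) p')))) * (V j t ![((p, σ), 1), ((p', σ), 0), (((omega0 M, y), 0), 0), (((omega0 M, x), 0), 1)] * V j t ![((p, σ), 0), ((p', σ), 1), ((((omega0 M).rev, Qm - y), 1), 0), ((((omega0 M).rev, Qm - x), 1), 1)]) else 0)‖ ≤
      (P.Klam * U) ^ 2 * (zD * ((4 : ℝ) ^ (n + 1))⁻¹ + hD * ((4 : ℝ) ^ (nScales β - n))⁻¹ + wD * ((2 : ℝ) ^ n)⁻¹ + lD * ((L : ℝ))⁻¹ + tD * min (klTorusNorm L (x - y) / klScale klE0 (n + 1)) (klScale klE0 (n + 1) / klTorusNorm L (x - y)))) ∧ (1 ≤ n → j' = n + 1 → n + 3 ≤ nScales β → ∀ t ∈ Icc (0 : ℝ) 1, ∀ x y : TorusSite 2 L, (4 + 8 / 3 * R.Gfr 1 * U ^ 2) * klTorusNorm L (x + y - Qm) < klScale klE0 (n + 1) / 16 →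
      ((klScale klE0 n - klScale klE0 (n + 1)) * ((β * (L : ℝ) ^ 2) ^ 3)⁻¹) * ‖(∑ p : FreqMomentum L M, ∑ p' : FreqMomentum L M, if matsubaraInt M p'.1 + matsubaraInt M (omega0 M) + matsubaraInt M (omega0 M) + 1 = matsubaraInt M p.1 ∧ p'.2 = p.2 + Qm - x - y then
      ((((((((softSymbolCompl L M β μ (klFlowFrameU L M β U μ (n + 1)) (n + 1) j) p - (softSymbolCompl L M β μ (klFlowFrameU L M β U μ (n + 1)) (n + 1) j') p)) : ℝ) : ℂ) * (((β * (L : ℝ) ^ 2 : ℝ) : ℂ) * propCT L M β μ (klFlowFrameU L M β U μ (n + 1)) p)) * ((((Wd t p') : ℝ) : ℂ) * (((β * (L : ℝ) ^ 2 : ℝ) : ℂ) * propCT L M β μ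
      (klFlowFrameU L M β U μ (n + 1)) p'))) + (((((Wd t p) : ℝ) : ℂ) * (((β * (L : ℝ) ^ 2 : ℝ) : ℂ) * propCT L M β μ (klFlowFrameU L M β U μ (n + 1)) p)) * ((((((softSymbolCompl L M β μ (klFlowFrameU L M β U μ (n + 1)) (n + 1) j) p' - (softSymbolCompl L M β μ (klFlowFrameU L M β U μ (n + 1)) (n + 1) j') p')) : ℝ) :
      ℂ) * (((β * (L : ℝ) ^ 2 : ℝ) : ℂ) * propCT L M β μ (klFlowFrameU L M β U μ (n + 1)) p')))) * (V j t ![((p, 0), 1), ((p', 1), 0), (((omega0 M, y), 0), 0), ((((omega0 M).rev, Qm - x), 1), 1)] * V j t ![((p, 0), 0), ((p', 1), 1), ((((omega0 M).rev, Qm - y), 1), 0), (((omega0 M, x), 0), 1)]) else 0)‖ ≤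
      (P.Klam * U) ^ 2 * (zX * ((4 : ℝ) ^ (n + 1))⁻¹ + hX * ((4 : ℝ) ^ (nScales β - n))⁻¹ + wX * ((2 : ℝ) ^ n)⁻¹ + lX * ((L : ℝ))⁻¹ + tX * min (klTorusNorm L (x + y - Qm) / klScale klE0 (n + 1)) (klScale klE0 (n + 1) / klTorusNorm L (x + y - Qm)))) ∧
      -- «88b» v2 (#15): the SIGNED born `D`-row at the pinned pair keyed to a free number `bP` in the overlap slot's shape (class #1's `TwoLegSlopes`/`KernelNormsV3` currency)
      (1 ≤ n → j' = n + 1 → ∀ t ∈ Icc (0 : ℝ) 1, ∀ x y : TorusSite 2 L,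
      ((klScale klE0 n - klScale klE0 (n + 1)) * ((β * (L : ℝ) ^ 2) ^ 3)⁻¹) *
      ‖(∑ p : FreqMomentum L M, ∑ σ : Fin 2,
      (((((Wd t p) : ℝ) : ℂ) * (((β * (L : ℝ) ^ 2 : ℝ) : ℂ) * propCT L M β μ (klFlowFrameU L M β U μ (n + 1)) p)) * ((((((softSymbolCompl L M β μ (klFlowFrameU L M β U μ (n + 1))
      (n + 1) j) p - (softSymbolCompl L M β μ (klFlowFrameU L M β U μ (n + 1)) (n + 1) j') p)) : ℝ) : ℂ) * (((β * (L : ℝ) ^ 2 : ℝ) : ℂ) * propCT L M β μ (klFlowFrameU L M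
      β U μ (n + 1)) p))) *
      (V6 j t ![((p, σ), 0), ((p, σ), 1), (((omega0 M, y), 0), 0), ((((omega0 M).rev, Qm - y), 1), 0), ((((omega0 M).rev, Qm - x), 1), 1),
      (((omega0 M, x), 0), 1)] *
      Sg j t p σ))‖ ≤
      (P.Klam * U) ^ 2 * bP * ((4 : ℝ) ^ (n + 1))⁻¹) ∧ (∀ t ∈ Icc (0 : ℝ) 1, ∀ m' (i : Fin (2 * m')) (w : GridLeg (GridPoint L (2 * (2 * M)))),
      ∑ Y ∈ univ.filter (fun Y : Fin (2 * m') → GridLeg (GridPoint L (2 * (2 * M))) => Y i = w), ‖kernel ℂ (effAction ℂ ((hubbardGridSub L M β (2 * (2 * M))).transpose * hubbardCovAboveCT L M β μ 0 (klFlowFrameU L M β U μ (n + 1)) (klScale klE0 n + t * (klScale klE0 (n + 1) - klScale klE0 n)) * hubbardGridSub L M β (2 * (2 * M)))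
      (hubbardGridInteraction L (2 * (2 * M)) β U + hubbardGridCounterQuadratic L (2 * (2 * M)) β (klFlowFrameU L M β U μ (n + 1)))) (2 * m') Y‖ ≤ Ng m') ∧ (((2 * 2).factorial : ℝ) / (β * (L : ℝ) ^ 2) * (Fintype.card (GridLeg (GridPoint L (2 * (2 * M)))) *
      ∑ m' ∈ range (Fintype.card (GridLeg (GridPoint L (2 * (2 * M)))) / 2 + 1), if 2 ≤ m' then ((2 * m').choose (2 * 2) : ℝ) * Real.sqrt 6047 ^ (2 * m' - 2 * 2) * Ng m' else 0) ≤ M4) ∧ (((2 * 3).factorial : ℝ) / (β * (L : ℝ) ^ 2) * (Fintype.card (GridLeg (GridPoint L (2 * (2 * M)))) *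
      ∑ m' ∈ range (Fintype.card (GridLeg (GridPoint L (2 * (2 * M)))) / 2 + 1), if 3 ≤ m' then ((2 * m').choose (2 * 3) : ℝ) * Real.sqrt 6047 ^ (2 * m' - 2 * 3) * Ng m' else 0) ≤ M6) ∧ (((2 * 1).factorial : ℝ) / (β * (L : ℝ) ^ 2) * (Fintype.card (GridLeg (GridPoint L (2 * (2 * M)))) *
      ∑ m' ∈ range (Fintype.card (GridLeg (GridPoint L (2 * (2 * M)))) / 2 + 1), if 1 ≤ m' then ((2 * m').choose (2 * 1) : ℝ) * Real.sqrt 6047 ^ (2 * m' - 2 * 1) * Ng m' else 0) ≤ M2) ∧ (((2 * 2).factorial : ℝ) / (β * (L : ℝ) ^ 2) * (Fintype.card (GridLeg (GridPoint L (2 * (2 * M)))) *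
      ∑ m' ∈ range (Fintype.card (GridLeg (GridPoint L (2 * (2 * M)))) / 2 + 1), if 2 < m' then ((2 * m').choose (2 * 2) : ℝ) * Real.sqrt (klScale klE0 (n + 1) * klIdxMass (n + 1) j') ^ (2 * m' - 2 * 2) * (∑ m'' ∈ range (Fintype.card (GridLeg (GridPoint L (2 * (2 * M)))) / 2 + 1), if m' ≤ m'' then ((2 * m'').choose (2 * m') : ℝ) * Real.sqrt 6047 ^ (2 * m'' - 2 * m') * Ng m'' else 0) else 0) ≤ η4) ∧
      (((2 * 3).factorial : ℝ) / (β * (L : ℝ) ^ 2) * (Fintype.card (GridLeg (GridPoint L (2 * (2 * M)))) *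
      ∑ m' ∈ range (Fintype.card (GridLeg (GridPoint L (2 * (2 * M)))) / 2 + 1), if 3 < m' then ((2 * m').choose (2 * 3) : ℝ) * Real.sqrt (klScale klE0 (n + 1) * klIdxMass (n + 1) j') ^ (2 * m' - 2 * 3) * (∑ m'' ∈ range (Fintype.card (GridLeg (GridPoint L (2 * (2 * M)))) / 2 + 1), if m' ≤ m'' then ((2 * m'').choose (2 * m') : ℝ) * Real.sqrt 6047 ^ (2 * m'' - 2 * m') * Ng m'' else 0) else 0) ≤ η6) ∧
      (((2 * 1).factorial : ℝ) / (β * (L : ℝ) ^ 2) * (Fintype.card (GridLeg (GridPoint L (2 * (2 * M)))) *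
      ∑ m' ∈ range (Fintype.card (GridLeg (GridPoint L (2 * (2 * M)))) / 2 + 1), if 1 < m' then ((2 * m').choose (2 * 1) : ℝ) * Real.sqrt (klScale klE0 (n + 1) * klIdxMass (n + 1) j') ^ (2 * m' - 2 * 1) * (∑ m'' ∈ range (Fintype.card (GridLeg (GridPoint L (2 * (2 * M)))) / 2 + 1), if m' ≤ m'' then ((2 * m'').choose (2 * m') : ℝ) * Real.sqrt 6047 ^ (2 * m'' - 2 * m') * Ng m'' else 0) else 0) ≤ η2) ∧
      -- SIZE ROWS (cell STATUS (R253) size model; k3c1-p1 g16 rows 89–92): the kernel numbers in units of `U` / the D-line Gram currency `κD² = Λₙ₊₁·klIdxMass (n+1) j′`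
      0 ≤ M4 ∧ 0 ≤ M6 ∧ 0 ≤ M2 ∧ 0 ≤ η4 ∧ 0 ≤ η6 ∧ 0 ≤ η2 ∧ 0 ≤ c₄ ∧ 0 ≤ c₆ ∧ 0 ≤ c₂ ∧ 0 ≤ e₄ ∧ 0 ≤ e₆ ∧ 0 ≤ e₂ ∧ 0 ≤ sₑ ∧ M4 ≤ c₄ * U ∧ M6 ≤ c₆ * U ∧ M2 ≤ c₂ * U ∧ η4 ≤ e₄ * U * (klScale klE0 (n + 1) * klIdxMass (n + 1) j') ∧ η6 ≤ e₆ * U * (klScale klE0 (n + 1) * klIdxMass (n + 1) j') ∧ η2 ≤ e₂ * U * (klScale klE0 (n + 1) * klIdxMass (n + 1) j') ∧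
      (∀ t ∈ Icc (0 : ℝ) 1, ∀ x y : TorusSite 2 L, ‖Hd j t ![(((omega0 M, y), 0), 0), ((((omega0 M).rev, Qm - y), 1), 0), ((((omega0 M).rev, Qm - x), 1), 1), (((omega0 M, x), 0), 1)]‖ ≤ RH₁ x y) ∧ (∀ t ∈ Icc (0 : ℝ) 1, ∀ x y : TorusSite 2 L, ‖Hd j' t ![(((omega0 M, y), 0), 0), ((((omega0 M).rev, Qm - y), 1), 0), ((((omega0 M).rev, Qm - x), 1), 1), (((omega0 M, x), 0), 1)]‖ ≤ RH₂ x y) ∧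
      (∀ t ∈ Icc (0 : ℝ) 1, ∀ x y : TorusSite 2 L, ‖Hd j t ![(((omega0 M, y), 0), 0), ((((omega0 M).rev, Qm - y), 1), 0), ((((omega0 M).rev, Qm - x), 1), 1), (((omega0 M, x), 0), 1)] - Hd j' t ![(((omega0 M, y), 0), 0), ((((omega0 M).rev, Qm - y), 1), 0), ((((omega0 M).rev, Qm - x), 1), 1), (((omega0 M, x), 0), 1)]‖ ≤ Rhd x y) ∧
      (∀ t ∈ Icc (0 : ℝ) 1, ∀ x y : TorusSite 2 L, ‖∑ z : TorusSite 2 L × MatsubaraIdx M, Br j Qm t z * ((if z.1 ∈ klBall L μ 0 then V j t ![(((omega0 M, z.1), 0), 0), ((((omega0 M).rev, Qm - z.1), 1), 0), ((((omega0 M).rev, Qm - x), 1), 1), (((omega0 M, x), 0), 1)] * V j t ![(((omega0 M, y), 0), 0), ((((omega0 M).rev, Qm - y), 1), 0), ((((omega0 M).rev, Qm - z.1), 1), 1), (((omega0 M, z.1), 0), 1)] else 0) -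
      V j t ![(((z.2, z.1), 0), 0), (((z.2.rev, Qm - z.1), 1), 0), ((((omega0 M).rev, Qm - x), 1), 1), (((omega0 M, x), 0), 1)] * V j t ![(((omega0 M, y), 0), 0), ((((omega0 M).rev, Qm - y), 1), 0), (((z.2.rev, Qm - z.1), 1), 1), (((z.2, z.1), 0), 1)])‖ ≤ RL₁ x y) ∧ (∀ t ∈ Icc (0 : ℝ) 1, ∀ x y : TorusSite 2 L, ‖∑ z : TorusSite 2 L × MatsubaraIdx M, Br j' Qm t z * ((if z.1 ∈ klBall L μ 0 then
      V j' t ![(((omega0 M, z.1), 0), 0), ((((omega0 M).rev, Qm - z.1), 1), 0), ((((omega0 M).rev, Qm - x), 1), 1), (((omega0 M, x), 0), 1)] * V j' t ![(((omega0 M, y), 0), 0), ((((omega0 M).rev, Qm - y), 1), 0), ((((omega0 M).rev, Qm - z.1), 1), 1), (((omega0 M, z.1), 0), 1)] else 0) - V j' t ![(((z.2, z.1), 0), 0), (((z.2.rev, Qm - z.1), 1), 0), ((((omega0 M).rev, Qm - x), 1), 1), (((omega0 M, x), 0), 1)] *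
      V j' t ![(((omega0 M, y), 0), 0), ((((omega0 M).rev, Qm - y), 1), 0), (((z.2.rev, Qm - z.1), 1), 1), (((z.2, z.1), 0), 1)])‖ ≤ RL₂ x y) ∧ (∀ t ∈ Icc (0 : ℝ) 1, ∀ x y : TorusSite 2 L, ‖∑ z : TorusSite 2 L × MatsubaraIdx M, (fun z : TorusSite 2 L × MatsubaraIdx M => -(((((β * (L : ℝ) ^ 2 : ℝ) : ℂ)))⁻¹ * propCT L M β μ (klFlowFrameU L M β U μ (n + 1)) (z.2, z.1) * propCT L M β μ
      (klFlowFrameU L M β U μ (n + 1)) (z.2.rev, Qm - z.1)) * ((((klScale klE0 (n + 1) - klScale klE0 n) * (-Wd t (z.2, z.1) * ((softSymbolCompl L M β μ (klFlowFrameU L M β U μ (n + 1)) (n + 1) j) (z.2.rev, Qm - z.1) - (softSymbolCompl L M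
      β μ (klFlowFrameU L M β U μ (n + 1)) (n + 1) j') (z.2.rev, Qm - z.1)) - ((softSymbolCompl L M β μ (klFlowFrameU L M β U μ (n + 1)) (n + 1) j) (z.2, z.1) - (softSymbolCompl L M β μ (klFlowFrameU L M β U μ (n + 1)) (n + 1) j') (z.2, z.1)) * Wd t (z.2.rev, Qm - z.1))) : ℝ) : ℂ)) z * ((if z.1 ∈ klBall L μ 0 then
      V j t ![(((omega0 M, z.1), 0), 0), ((((omega0 M).rev, Qm - z.1), 1), 0), ((((omega0 M).rev, Qm - x), 1), 1), (((omega0 M, x), 0), 1)] * V j t ![(((omega0 M, y), 0), 0), ((((omega0 M).rev, Qm - y), 1), 0), ((((omega0 M).rev, Qm - z.1), 1), 1), (((omega0 M, z.1), 0), 1)] else 0) - V j t ![(((z.2, z.1), 0), 0), (((z.2.rev, Qm - z.1), 1), 0), ((((omega0 M).rev, Qm - x), 1), 1), (((omega0 M, x), 0), 1)] *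
      V j t ![(((omega0 M, y), 0), 0), ((((omega0 M).rev, Qm - y), 1), 0), (((z.2.rev, Qm - z.1), 1), 1), (((z.2, z.1), 0), 1)])‖ ≤ Rl₁ x y) ∧ (∀ t ∈ Icc (0 : ℝ) 1, ∀ x y : TorusSite 2 L, ‖∑ z : TorusSite 2 L × MatsubaraIdx M, Br j' Qm t z * (((if z.1 ∈ klBall L μ 0 then V j t ![(((omega0 M, z.1), 0), 0), ((((omega0 M).rev, Qm - z.1), 1), 0), ((((omega0 M).rev, Qm - x), 1), 1), (((omega0 M, x), 0), 1)] *
      V j t ![(((omega0 M, y), 0), 0), ((((omega0 M).rev, Qm - y), 1), 0), ((((omega0 M).rev, Qm - z.1), 1), 1), (((omega0 M, z.1), 0), 1)] else 0) - V j t ![(((z.2, z.1), 0), 0), (((z.2.rev, Qm - z.1), 1), 0), ((((omega0 M).rev, Qm - x), 1), 1), (((omega0 M, x), 0), 1)] * V j t ![(((omega0 M, y), 0), 0), ((((omega0 M).rev, Qm - y), 1), 0), (((z.2.rev, Qm - z.1), 1), 1), (((z.2, z.1), 0), 1)]) -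
      ((if z.1 ∈ klBall L μ 0 then V j' t ![(((omega0 M, z.1), 0), 0), ((((omega0 M).rev, Qm - z.1), 1), 0), ((((omega0 M).rev, Qm - x), 1), 1), (((omega0 M, x), 0), 1)] * V j' t ![(((omega0 M, y), 0), 0), ((((omega0 M).rev, Qm - y), 1), 0), ((((omega0 M).rev, Qm - z.1), 1), 1), (((omega0 M, z.1), 0), 1)] else 0) -
      V j' t ![(((z.2, z.1), 0), 0), (((z.2.rev, Qm - z.1), 1), 0), ((((omega0 M).rev, Qm - x), 1), 1), (((omega0 M, x), 0), 1)] * V j' t ![(((omega0 M, y), 0), 0), ((((omega0 M).rev, Qm - y), 1), 0), (((z.2.rev, Qm - z.1), 1), 1), (((z.2, z.1), 0), 1)]))‖ ≤ Rl₂ x y) ∧ (∀ x y, ‖klMemberArrayF L M β U μ n (softSymbolCompl L M β μ (klFlowFrameU L M β U μ n) n j) Qm x y‖ ≤ mA U) ∧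
      -- (F)(i) [k3c2-p2]: majorants of the FRAME SHIFT `K_n → K_(n+1)` of the history members / relative weight (model objects)
      (∀ x y, ‖(((Matrix.of fun k k' : TorusSite 2 L => if k ∈ klBall L μ 0 ∧ k' ∈ klBall L μ 0 then klCovSmearedPairAmplitude L M β U μ (klFlowFrameU L M β U μ (n + 1)) n (softCovOf L M β μ (klFlowFrameU L M β U μ (n + 1)) (softSymbolCompl L M β μ (klFlowFrameU L M β U μ (n + 1)) n j)) Qm k k' else 0) - klMemberArrayF L M β U μ n (softSymbolCompl L M β μ (klFlowFrameU L M β U μ n) n j) Qm) -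
      ((Matrix.of fun k k' : TorusSite 2 L => if k ∈ klBall L μ 0 ∧ k' ∈ klBall L μ 0 then klCovSmearedPairAmplitude L M β U μ (klFlowFrameU L M β U μ (n + 1)) n (softCovOf L M β μ (klFlowFrameU L M β U μ (n + 1)) (softSymbolCompl L M β μ (klFlowFrameU L M β U μ (n + 1)) n j')) Qm k k' else 0) - klMemberArrayF L M β U μ n (softSymbolCompl L M β μ (klFlowFrameU L M β U μ n) n j') Qm)) x y‖ ≤ ηr x y) ∧
      (∀ x y, ‖((Matrix.of fun k k' : TorusSite 2 L => if k ∈ klBall L μ 0 ∧ k' ∈ klBall L μ 0 then klCovSmearedPairAmplitude L M β U μ (klFlowFrameU L M β U μ (n + 1)) n (softCovOf L M β μ (klFlowFrameU L M β U μ (n + 1)) (softSymbolCompl L M β μ (klFlowFrameU L M β U μ (n + 1)) n j)) Qm k k' else 0) - klMemberArrayF L M β U μ n (softSymbolCompl L M β μ (klFlowFrameU L M β U μ n) n j) Qm) x y‖ ≤ η₁ x y) ∧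
      (∀ x y, ‖((Matrix.of fun k k' : TorusSite 2 L => if k ∈ klBall L μ 0 ∧ k' ∈ klBall L μ 0 then klCovSmearedPairAmplitude L M β U μ (klFlowFrameU L M β U μ (n + 1)) n (softCovOf L M β μ (klFlowFrameU L M β U μ (n + 1)) (softSymbolCompl L M β μ (klFlowFrameU L M β U μ (n + 1)) n j')) Qm k k' else 0) - klMemberArrayF L M β U μ n (softSymbolCompl L M β μ (klFlowFrameU L M β U μ n) n j') Qm) x y‖ ≤ η₂ x y) ∧
      (∀ c, ‖(fun p => -(((klTransferWeight L M β μ (klFlowFrameU L M β U μ (n + 1)) n (softSymbolCompl L M β μ (klFlowFrameU L M β U μ (n + 1)) n j) Qm p - klTransferWeight L M β μ (klFlowFrameU L M β U μ (n + 1)) n (softSymbolCompl L M β μ (klFlowFrameU L M β U μ (n + 1)) n j') Qm p : ℝ)) : ℂ)) c -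
      (-(((klTransferWeight L M β μ (klFlowFrameU L M β U μ n) n (softSymbolCompl L M β μ (klFlowFrameU L M β U μ n) n j) Qm c - klTransferWeight L M β μ (klFlowFrameU L M β U μ n) n (softSymbolCompl L M β μ (klFlowFrameU L M β U μ n) n j') Qm c : ℝ)) : ℂ))‖ ≤ d c) ∧
      (∀ x y, (ηr x y + mA U * ∑ c, η₁ x c * (d c + ‖(-(((klTransferWeight L M β μ (klFlowFrameU L M β U μ n) n (softSymbolCompl L M β μ (klFlowFrameU L M β U μ n) n j) Qm c - klTransferWeight L M β μ (klFlowFrameU L M β U μ n) n (softSymbolCompl L M β μ (klFlowFrameU L M β U μ n) n j') Qm c : ℝ)) : ℂ))‖) + mA U * mA U * ∑ c, d c + mA U * ∑ c, ‖(-(((klTransferWeight L M β μ (klFlowFrameU L M β U μ n) n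
      (softSymbolCompl L M β μ (klFlowFrameU L M β U μ n) n j) Qm c - klTransferWeight L M β μ (klFlowFrameU L M β U μ n) n (softSymbolCompl L M β μ (klFlowFrameU L M β U μ n) n j') Qm c : ℝ)) : ℂ))‖ * η₂ c y) ≤ R₀ x y) ∧
      -- a majorant `Φ` of the FUNCTION part of the reorganised analytic majorant (history 4-point rows, localisation rows, (F)(i): owners class #1 / (c) closer / k3c2-p2)
      (∀ x y, R₀ x y + ((klScale klE0 n - klScale klE0 (n + 1)) * (2⁻¹ * Rhd x y) + (Rl₁ x y + Rl₂ x y) + mA U * ∑ c, ((klScale klE0 n - klScale klE0 (n + 1)) * (2⁻¹ * RH₁ x c + ((β * (L : ℝ) ^ 2) ^ 3)⁻¹ * (2 * (M6 * M2 * ((1024 * 15367 : ℝ) / ((klScale klE0 n - klScale klE0 (n + 1)) * ((β * (L : ℝ) ^ 2) ^ 3)⁻¹))))) + RL₁ x c) *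
      (|klTransferWeight L M β μ (klFlowFrameU L M β U μ (n + 1)) (n + 1) (softSymbolCompl L M β μ (klFlowFrameU L M β U μ (n + 1)) (n + 1) j) Qm c - klTransferWeight L M β μ (klFlowFrameU L M β U μ (n + 1)) (n + 1) (softSymbolCompl L M β μ (klFlowFrameU L M β U μ (n + 1)) (n + 1) j') Qm c| +
      (klBubbleMaj L M β μ (klFlowFrameU L M β U μ (n + 1)) (fun k => (softSymbolCompl L M β μ (klFlowFrameU L M β U μ (n + 1)) (n + 1) j) k - (softSymbolCompl L M β μ (klFlowFrameU L M β U μ (n + 1)) (n + 1) j') k) (softSymbolCompl L M β μ (klFlowFrameU L M β U μ (n + 1)) n (n + 1)) Qm c +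
      klBubbleMaj L M β μ (klFlowFrameU L M β U μ (n + 1)) (softSymbolCompl L M β μ (klFlowFrameU L M β U μ (n + 1)) n (n + 1)) (fun k => (softSymbolCompl L M β μ (klFlowFrameU L M β U μ (n + 1)) (n + 1) j) k - (softSymbolCompl L M β μ (klFlowFrameU L M β U μ (n + 1)) (n + 1) j') k) Qm c)) +
      mA U * ∑ c, (|klTransferWeight L M β μ (klFlowFrameU L M β U μ (n + 1)) (n + 1) (softSymbolCompl L M β μ (klFlowFrameU L M β U μ (n + 1)) (n + 1) j) Qm c - klTransferWeight L M β μ (klFlowFrameU L M β U μ (n + 1)) (n + 1) (softSymbolCompl L M β μ (klFlowFrameU L M β U μ (n + 1)) (n + 1) j') Qm c| +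
      (klBubbleMaj L M β μ (klFlowFrameU L M β U μ (n + 1)) (fun k => (softSymbolCompl L M β μ (klFlowFrameU L M β U μ (n + 1)) (n + 1) j) k - (softSymbolCompl L M β μ (klFlowFrameU L M β U μ (n + 1)) (n + 1) j') k) (softSymbolCompl L M β μ (klFlowFrameU L M β U μ (n + 1)) n (n + 1)) Qm c +
      klBubbleMaj L M β μ (klFlowFrameU L M β U μ (n + 1)) (softSymbolCompl L M β μ (klFlowFrameU L M β U μ (n + 1)) n (n + 1)) (fun k => (softSymbolCompl L M β μ (klFlowFrameU L M β U μ (n + 1)) (n + 1) j) k - (softSymbolCompl L M β μ (klFlowFrameU L M β U μ (n + 1)) (n + 1) j') k) Qm c)) * ((klScale klE0 n - klScale klE0 (n + 1)) * (2⁻¹ * RH₂ c y + ((β * (L : ℝ) ^ 2) ^ 3)⁻¹ * (2 * (M6 * M2 * ((1024 * 15367 : ℝ) / ((klScale klE0 n - klScale klE0 (n + 1)) * ((β * (L : ℝ) ^ 2) ^ 3)⁻¹))))) + RL₂ c y)) ≤ Φ x y) ∧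
      -- (B1) OWNERS' SHARE (φ = 1/2, cell STATUS (R243)): the dressed FUNCTION-part majorant `𝒟[Φ](k,k′)` against the frame slack of the inherited bar plus HALF of three fifths of the ROOM
      (∀ k ∈ klBall L μ 0, ∀ k' ∈ klBall L μ 0, Φ k k' + ∑ c, Φ k c * ρ j' Qm c * (3 / 2 * mA U) + ∑ a', 3 / 2 * mA U * ρ j Qm a' * Φ a' k' + ∑ a', ∑ c, 3 / 2 * mA U * ρ j Qm a' * Φ a' c * ρ j' Qm c * (3 / 2 * mA U) ≤ (1 / 5 : ℝ) * (((2 : ℝ) ^ (n + 2))⁻¹ * transferBarRelIdx L klEngGeoTh P klCTcap8 β U n j' Qm k k' + 2⁻¹ * (3 / 5 * (klIdxPrefactor klCTcap8 (n + 1) * ((P.Klam * U) ^ 2 *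
      ((min (klTorusNorm L (k - k') / klScale klE0 (n + 1)) (klScale klE0 (n + 1) / klTorusNorm L (k - k')) + min (klTorusNorm L (k + k' - Qm) / klScale klE0 (n + 1)) (klScale klE0 (n + 1) / klTorusNorm L (k + k' - Qm)) + ((2 : ℝ) ^ n)⁻¹ + 3 * ((L : ℝ))⁻¹) * klIdxMass n j' + ((4 : ℝ) ^ (n + 1))⁻¹ * klIdxOverlap (n + 1) j') +
      ((P.Klam * |U|) ^ 3 * ((2 : ℝ) ^ n)⁻¹ + 3 * thermalBar klEngGeoTh P U β (n + 1)) * klIdxMass n j'))))) ∧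
      -- (T2)/(T3) THRESHOLD rows of the `min`-slot coefficients (rows (B2)/(B3) discharged by `klbd_scalarRow_direct/crossed_of_sizes`, k3c1-p1 g16 row 89)
      (1 ≤ n → klTS * (1156 * c₄ ^ 2 + 2 ^ 28 * ((4 : ℝ) ^ n)⁻¹ * (e₄ * c₄)) ≤ 9 / 20 * ((1 / 5 : ℝ) * (klCTcap8 * P.Klam ^ 2))) ∧ (1 ≤ n → klTS * (2712 * c₄ ^ 2 + 2 ^ 27 * ((4 : ℝ) ^ n)⁻¹ * (e₄ * c₄)) ≤ 9 / 20 * ((1 / 5 : ℝ) * (klCTcap8 * P.Klam ^ 2))) ∧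
      -- (T2p)/(T3p) THRESHOLD rows AT THE PINNED PAIR ((B2″)/(B3″) discharged by `klpp_scalarRow_direct/crossed_pinned_of_sizes`, k3c1-p1 g17)
      (1 ≤ n → j' = n + 1 → klTS * (3081 * c₄ ^ 2 + 2 ^ 28 * ((4 : ℝ) ^ n)⁻¹ * (e₄ * c₄)) + 4 / 15367 * (tD * P.Klam ^ 2) ≤ 9 / 20 * ((1 / 5 : ℝ) * (klCTcap8 * P.Klam ^ 2))) ∧ (1 ≤ n → j' = n + 1 → klTS * (6161 * c₄ ^ 2 + 2 ^ 27 * ((4 : ℝ) ^ n)⁻¹ * (e₄ * c₄)) + 4 / 15367 * (tX * P.Klam ^ 2) ≤ 9 / 20 * ((1 / 5 : ℝ) * (klCTcap8 * P.Klam ^ 2))) ∧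
      -- (T4) THRESHOLD rows of the constant part (row (B4) discharged at n = 0 / in the interior / at the crossed top edge by rows 90/91/92; `Ish := 2n+8`, `Iw := 2n+10`)
      (n = 0 → (3220 * sₑ + 136) * c₄ ^ 2 + 2147 * sₑ * (c₆ * c₂) + 3100000 * (e₄ * c₄) + 1031000 * (e₆ * c₂ + c₆ * e₂) ≤ 9 / 20 * ((1 / 5 : ℝ) * (klCTcap8 * P.Klam ^ 2))) ∧ (1 ≤ n → n + 2 ≤ j' → 608 * (klTS * c₄ ^ 2) + 1 / 3 * c₄ ^ 2 + 860000 * (klTS * c₄ * e₄) + 1550000 * (c₄ * e₄) + 516000 * (c₂ * e₆ + c₆ * e₂) ≤ 9 / 20 * ((1 / 5 : ℝ) * (klCTcap8 * P.Klam ^ 2))) ∧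
      (1 ≤ n → n + 2 ≤ j' → ¬(n + 3 ≤ nScales β) → 1073 * (sₑ * c₄ ^ 2) ≤ 27 / 80 * ((1 / 5 : ℝ) * (klCTcap8 * (klEngGeoTh.CF * P.Klam ^ 2)))) ∧
      -- the EDGE SOFT MASS of the pair's D-line at scale n in index-mass units («(X).3-D-EDGE» pricing, k3c2-p2)
      (0 ≤ klSoftMass L M β μ (klFlowFrameU L M β U μ (n + 1)) n (fun p => softSymbolCompl L M β μ (klFlowFrameU L M β U μ (n + 1)) (n + 1) j p - softSymbolCompl L M β μ (klFlowFrameU L M β U μ (n + 1)) (n + 1) j' p) ∧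
      klSoftMass L M β μ (klFlowFrameU L M β U μ (n + 1)) n (fun p => softSymbolCompl L M β μ (klFlowFrameU L M β U μ (n + 1)) (n + 1) j p - softSymbolCompl L M β μ (klFlowFrameU L M β U μ (n + 1)) (n + 1) j' p) ≤ sₑ * klIdxMass n j') ∧
      -- (T4p) the PINNED pair's (B4″) from sizes: thresholds for the `2⁻ⁿ` slot, the `3/L` slot, the thermal slot and (top edge) the flat soft mass — `klpp_scalarRow_const_pinned(_top)_of_sizes`
      (1 ≤ n → j' = n + 1 → (2520966 : ℝ) * (klTS * c₄ ^ 2) + (3303243395 : ℝ) * (klTS * c₄ * e₄) + (1207 : ℝ) * (c₄ ^ 2) + (5939464501 : ℝ) * (c₄ * e₄) + (1979821501 : ℝ) * (c₆ * e₂) + (1979821501 : ℝ) * (c₂ * e₆) + (131 / 1000 : ℝ) * (P.Klam ^ 2 * zD) + (21 / 20 : ℝ) * (P.Klam ^ 2 * wD) + (909 / 100000 : ℝ) * (P.Klam ^ 2 * tD) + (131 / 1000 : ℝ) * (P.Klam ^ 2 * zX) + (21 / 20 : ℝ) * (P.Klam ^ 2 * wX) + (909 / 100000 : ℝ) * (P.Klam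 ^ 2 * tX) + (131 / 500 : ℝ) * (P.Klam ^ 2 * bP) ≤ 9 / 20 * (15367 / 4) * ((1 / 5 : ℝ) * (klCTcap8 * P.Klam ^ 2))) ∧ (1 ≤ n → j' = n + 1 → (21 / 20 : ℝ) * (P.Klam ^ 2 * lD) + (21 / 20 : ℝ) * (P.Klam ^ 2 * lX) ≤ 27 / 20 * (15367 / 4) * ((1 / 5 : ℝ) * (klCTcap8 * P.Klam ^ 2))) ∧
      (1 ≤ n → j' = n + 1 → (21 / 20 : ℝ) * (P.Klam ^ 2 * hD) + (21 / 20 : ℝ) * (P.Klam ^ 2 * hX) ≤ 27 / 40 * (15367 / 4) * ((1 / 5 : ℝ) * (klCTcap8 * (klEngGeoTh.CF * P.Klam ^ 2)))) ∧ (1 ≤ n → j' = n + 1 → ¬(n + 3 ≤ nScales β) → (4122750 : ℝ) * (sₑ * c₄ ^ 2) ≤ 27 / 160 * (15367 / 4) * ((1 / 5 : ℝ) * (klCTcap8 * (klEngGeoTh.CF * P.Klam ^ 2))))) ∧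
      -- `hexport`
      (klEngGeo14.WF → ∀ Q : EngConsts, (klEngQ7 P R).IsRaiseOf Q → ∀ cc : ℝ, 0 < cc → cc ≤ klEngC₃6 P R →
      ∀ μ ∈ klWindowC, ∀ U : ℝ, 0 < U → U ≤ klEngU₀10 P R cc → U ≤ u Q cc → ∀ β : ℝ, klBetaMin ≤ β → β ≤ Real.exp (cc / U ^ 2) → ∀ (L M : ℕ) [NeZero L] [NeZero M], klEngL₄ P R β U ≤ L → klEngM₃ β U L ≤ M → ∀ n : ℕ, n ≤ nScales β + 1 → IsKLRegime U cc (-((n : ℕ) : ℤ)) → HistP klPredsV17F2 L M klEngGeo14 P Q R β U μ 0 (n) → FrameOK R U (nScales β) μ (klFlowFrameU L M β U μ (n)) →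
      (∀ j ≤ n, LevelsUExportMixedAt L M (klCU2 P R (klEngQ7 P R)) P β U μ j) → ∀ j' : ℕ, n ≤ j' → j' ≤ nScales β + 1 → ∀ Qm : TorusSite 2 L, ∀ x y, ‖klMemberArrayF L M β U μ n (softSymbolCompl L M β μ (klFlowFrameU L M β U μ n) n j') Qm x y‖ ≤ mA U))
    (hX3 : ∀ (P : SplitConsts) (R : RenConsts), P.WF → R.WF2 →
      ∃ e : (ℕ → ℝ) × (EngConsts → ℝ → ℝ), IsSpaceMomPkg5Z R e ∧ TwoLegSpaceMomentsStep5 P R (klEngQ7 P R) klEngGeo14 e.1 e.2) :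
    ∀ (P : SplitConsts) (R : RenConsts), P.WF → R.WF2 → (∃ e : (ℕ → ℝ) × ℝ × (EngConsts → ℝ → ℝ), IsExportPkg2 e ∧ LevelsUStep2 P R (klEngQ7 P R) e.1 e.2.2) ∧
      (∃ e : ℝ × (EngConsts → ℝ → ℝ), IsTransferPkg8 e ∧ PairTransferStep7 P R (klEngQ7 P R) klEngGeo14 klEngGeoTh e.1 e.2) ∧
      (∃ e : (ℕ → ℝ) × (EngConsts → ℝ → ℝ), IsSpaceMomPkg5Z R e ∧ TwoLegSpaceMomentsStep5 P R (klEngQ7 P R) klEngGeo14 e.1 e.2) := by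
  intro P R hP hR
  refine ⟨hX1 P R hP hR, ?_, hX3 P R hP hR⟩
  obtain ⟨u, mA, hu, hmA, hbase, hsucc, hexport⟩ := h5 P R hP hR
  obtain ⟨e, he, hstep, -⟩ :=
    KLRegimeSplit.exists_isTransferPkg8_of_analytic_resolved_sized_klTS_pinned2sb_unguarded (P := P) (R := R) (Q₀ := klEngQ7 P R)
      (G := klEngGeo14) (Gth := klEngGeoTh) (r := klCTcap8) (θ := (1 / 5 : ℝ)) (u := u) mA hR klEngGeoTh_CF_nonneg (zero_le_one.trans hP.1) klCTcap8_pos.le le_rfl hu (by norm_num) le_rfl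
      (fun U μ β hμ => klFrameOK_zeroC hR.wf U (nScales β) hμ) hmA hbase hsucc hexport
  exact ⟨e, he, hstep⟩

end RowX

end Summit.HubbardSuperconductivity.HubbardSuperconductivity.Theorems.EngineV8.A24a1G14

end
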